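import Summits.KontsevichZagierPeriods.KontsevichZagierPeriods.Theses.LiouvilleUnfolding
import Literature.NumberTheory.Transcendental.KZLogCalculusProofs
import Literature.NumberTheory.Transcendental.KZIntervalPeriodProofs
import Literature.NumberTheory.Transcendental.SemialgebraicDerivativeProofs

/-!
# Disproof work file — crux `LiouvilleUnfolding.UnfoldedLogStokes` (stmt-KontsevichZagierPeriods-2835)

Standing adversary (refuter, cdisprove mode).  Everything in this file is sorry-free (axioms
propext / Classical.choice / Quot.sound).

VERDICT (cycles 1–3, gens 1–2): NO KILL — THE CRUX IS TRUE: `unfoldedLogStokes_holds : UnfoldedLogStokes`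
(§4; standalone copies attached to the item as candidate-proof evidence; the lead
`prover-line-stmt-KontsevichZagierPeriods-2835-0` is landing it along the registered stubs
`stub_velocityExtension` p74568 / `stub_nullNormalise` p74625 / `stub_foldIntegrable`, all ACCEPTED).
It is the tree theorem `KZ.unfoldedLogStokes_mem_relations` (KZLogCalculusProofs) plus glue (a)–(e)
written here.  The value invariant (`KZ.relations_le_ker_eval_holds`) — the only invariant of
`relations` — can never bite the crux (it is a kernel element by Tonelli + fibrewise FTC, §6 proves this
even without `hH`), but it DOES settle every variant below.  Contents:

* §0 `Orig`, `orig_iff` — verbatim copy of the crux (`Iff.rfl`), the text every variant edits.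
* §1 toolkit — honest one-variable representations over the one-point base `ℝ⁰` (`I`, `zeroRep`,
  `invRep = [D, 1/u]`, `r4inv = [[0,1], 1/(1+t)]`, value bounds `≥ 1/2`, null degenerate intervals),
  `values_of_mem_relations` (soundness in the crux's four-term shape), semialgebraic steps `sa_ite`.
* §2 LOAD-BEARING ANALYSIS — each ANALYTIC hypothesis is necessary ("any proof must use it"):
  `unfoldedLogStokes_false_without_hab` (a ≤ b; witness A: empty band, boundary terms survive),
  `not_posV` (`1 ≤ V` cannot be weakened to `0 < V`; witness B: `{1 ≤ u ≤ V}` computes `log⁺ V`),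
  `unfoldedLogStokes_false_without_contV` / `_without_contH` (endpoint VALUES vs interior; steps),
  `unfoldedLogStokes_false_without_derivH` / `_without_derivV` (`H'`, `V'` are free symbols otherwise).
* §3 REFUTED STRENGTHENINGS on the honest witness G (`H = 1, V = 1+t` on `[0,1]`): `not_bulk`
  (`[r₁]+[r₄]` alone), `not_boundary` (`[r₃]−[r₂]` alone), `not_wrongSign` (`+[r₂]−[r₃]`); and the
  sanity identity `G.value_r₂_eq_value_r₄` (`∫₁² du/u = ∫₀¹ dt/(1+t)`): G satisfies the crux.
* §4 THE CRUX HOLDS: `openBand`, `dExt` (+ `sa_dExt`: BPR Prop. 3.22 in tree, glued with 0 on the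
  edge graphs), `of_sub_of_mem_relations_of_eqOn_of_null` (agreeing off a null semialgebraic set ⇒
  equivalent), `integrableOn_of_lintegral_fibre_ge` (Tonelli, converse bookkeeping), and
  `unfoldedLogStokes_holds` (Ub := r₂, Ua := r₃.neg onto the tree theorem).
* §5 REDUNDANT HYPOTHESES (cycle 3): the semialgebraicity of `τ`, `a`, `b` AND of `V` is DERIVABLE from
  the honesty of `r₄`, `r₁` (+ `hab`, `hV1`): edge functions of a semialgebraic band with non-empty
  fibres are semialgebraic (`isSemialgebraicFunOn_upper_of_band` / `_lower_of_band`, one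
  Tarski–Seidenberg projection + complement).  `withoutSaData_iff : WithoutSaData ↔ UnfoldedLogStokes`,
  `withoutSaData_holds`.  (Planner: four clauses can be dropped from the statement verbatim.)
* §6 THE INVISIBLE HYPOTHESIS `hH` (cycle 3): with `IsSemialgebraicFunOn ℚ r₄.domain H` deleted the
  four values STILL cancel (`values_cancel_without_saH`, Fubini + FTC for `H log V`, no semialgebraicity
  of `H` used; `H'`, `H(·,b·)`, `H(·,a·)` are read off `r₁, r₂, r₃` at `u = 1`), hence
  `withoutSaH_of_kzKernelConjecture : KZKernelConjecture → WithoutSaH` and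
  `not_kzKernelConjecture_of_not_withoutSaH`: any kill of that variant DISPROVES THE PERIOD CONJECTURE.
  So the hypothesis ledger of the crux is complete: 7 analytic clauses load-bearing (§2), 4
  semialgebraic clauses redundant (§5), `hH` summit-hard to attack and used only for derivability.

Landed through the gate (Theorems/UnfoldedLogStokes/Negative/, namespace
`Summit.KontsevichZagierPeriods.LiouvilleUnfolding.UnfoldedLogStokesNegative`): `Kit.lean` p73334,
`LoadBearing.lean` p73925, `LoadBearingII.lean` p74152, `Strengthenings.lean` p74620 — all ACCEPTED
(gen 1); §5 / §6 proposed this cycle as `RedundantHypotheses.lean` / `InvisibleH.lean` (see NOTES).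

Dead ends for a disprover (do not retry): exact/numeric counterexample search (eval = 0 identically
under the hypotheses — §6 — and a derivation exists — §4); degenerate regimes (n = 0, a = b, V ≡ 1,
τ null or empty) give null or cancelling representations; dropping `τ/a/b/V`-semialgebraicity changes
nothing (§5); dropping `H`-semialgebraicity is invisible to eval and summit-hard (§6).
Learnings for provers of the ROUTE: the same glue pattern (dExt + null-set twins + Tonelli read-off)
discharges the analogous hypotheses-only-on-open-fibres / pinned-only-at-interior-t shape of
`LogPrimitiveNL` (stmt-2836) down to its genuinely new content, the boundary rigidity lemma; §5's edge
lemmas likewise delete the base-semialgebraicity hypotheses of `LogPrimitiveNL`; §6's value computation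
is the eval-soundness half of any future `KZlog`-style log-NL move with NON-semialgebraic coefficient.

-/


noncomputable section

set_option linter.dupNamespace false

open Set MeasureTheory MvPolynomial Filter Topology
open Literature.NumberTheory.Transcendental Literature.ModelTheory.ExponentialFields
open Literature.NumberTheory.Transcendental.SemialgebraicDerivative (sa_atom sa_lt)
open Summit.KontsevichZagierPeriods.KontsevichZagierPeriods.Theses.LiouvilleUnfolding (UnfoldedLogStokes)

namespace Summit.KontsevichZagierPeriods.KontsevichZagierPeriods.Cruxes.UnfoldedLogStokes.Disproof

/-! ## §0 The crux restated (text-fidelity anchor for the variants below) -/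

/-- Verbatim copy of the body of the route decl `LiouvilleUnfolding.UnfoldedLogStokes`; every
`…Without…` / strengthened variant below is obtained from THIS text by deleting or editing exactly
one clause, and `orig_iff` certifies the copy. -/
def Orig : Prop :=
  ∀ (n : ℕ) (τ : Set (Fin n → ℝ)) (a b : (Fin n → ℝ) → ℝ) (H H' V V' : (Fin (n + 1) → ℝ) → ℝ) (r₁ : Literature.NumberTheory.Transcendental.KZ.IntegralRep (n + 2)) (r₂ r₃ r₄ : Literature.NumberTheory.Transcendental.KZ.IntegralRep (n + 1)), Literature.ModelTheory.ExponentialFields.IsSemialgebraic ℚ τ →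
    Literature.NumberTheory.Transcendental.IsSemialgebraicFunOn ℚ τ a →
    Literature.NumberTheory.Transcendental.IsSemialgebraicFunOn ℚ τ b →
    (∀ x ∈ τ, a x ≤ b x) →
    r₄.domain = {z | (Fin.init z : Fin n → ℝ) ∈ τ ∧ a (Fin.init z) ≤ z (Fin.last n) ∧ z (Fin.last n) ≤ b (Fin.init z)} →
    Literature.NumberTheory.Transcendental.IsSemialgebraicFunOn ℚ r₄.domain H →
    Literature.NumberTheory.Transcendental.IsSemialgebraicFunOn ℚ r₄.domain V →
    (∀ z ∈ r₄.domain, 1 ≤ V z) →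
    (∀ x ∈ τ, ContinuousOn (fun t : ℝ => H (Fin.snoc x t)) (Set.Icc (a x) (b x)) ∧ ContinuousOn (fun t : ℝ => V (Fin.snoc x t)) (Set.Icc (a x) (b x))) →
    (∀ x ∈ τ, ∀ t ∈ Set.Ioo (a x) (b x), HasDerivAt (fun s : ℝ => H (Fin.snoc x s)) (H' (Fin.snoc x t)) t ∧ HasDerivAt (fun s : ℝ => V (Fin.snoc x s)) (V' (Fin.snoc x t)) t) →
    (∀ z ∈ r₄.domain, a (Fin.init z) < z (Fin.last n) → z (Fin.last n) < b (Fin.init z) → r₄.integrand z = H z * V' z / V z) →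
    r₁.domain = {w | (Fin.init w : Fin (n + 1) → ℝ) ∈ r₄.domain ∧ 1 ≤ w (Fin.last (n + 1)) ∧ w (Fin.last (n + 1)) ≤ V (Fin.init w)} →
    (∀ w ∈ r₁.domain, a (Fin.init (Fin.init w)) < Fin.init w (Fin.last n) → Fin.init w (Fin.last n) < b (Fin.init (Fin.init w)) → r₁.integrand w = H' (Fin.init w) / w (Fin.last (n + 1))) →
    r₂.domain = {z | (Fin.init z : Fin n → ℝ) ∈ τ ∧ 1 ≤ z (Fin.last n) ∧ z (Fin.last n) ≤ V (Fin.snoc (Fin.init z) (b (Fin.init z)))} →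
    (∀ z ∈ r₂.domain, r₂.integrand z = H (Fin.snoc (Fin.init z) (b (Fin.init z))) / z (Fin.last n)) →
    r₃.domain = {z | (Fin.init z : Fin n → ℝ) ∈ τ ∧ 1 ≤ z (Fin.last n) ∧ z (Fin.last n) ≤ V (Fin.snoc (Fin.init z) (a (Fin.init z)))} →
    (∀ z ∈ r₃.domain, r₃.integrand z = H (Fin.snoc (Fin.init z) (a (Fin.init z))) / z (Fin.last n)) →
    Literature.NumberTheory.Transcendental.KZ.of r₁ - Literature.NumberTheory.Transcendental.KZ.of r₂ + Literature.NumberTheory.Transcendental.KZ.of r₃ + Literature.NumberTheory.Transcendental.KZ.of r₄ ∈ Literature.NumberTheory.Transcendental.KZ.relations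

/-- The copy is the crux, definitionally. -/
theorem orig_iff : Orig ↔ UnfoldedLogStokes := Iff.rfl

/-! ## §1 Witness toolkit: honest one-variable representations over the one-point base

All counterexamples live in the smallest dimension `n = 0`: base `τ = ℝ⁰ = {pt}`, band `= [a, b]`
on the `t`-line, unfolded domains in the `(t, u)`-plane.  Soundness of the four moves
(`KZ.relations_le_ker_eval_holds`, PROVED in tree) is the only invariant used: a variant is refuted
by exhibiting honest representations satisfying its hypotheses whose signed values do not cancel. -/

/-- The one-point base `ℝ⁰`. -/
abbrev τ₀ : Set (Fin 0 → ℝ) := univ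

theorem sa_τ₀ : IsSemialgebraic ℚ τ₀ := isSemialgebraic_univ

section consts
variable {m : ℕ} {s : Set (Fin m → ℝ)}

theorem sa_zero (hs : IsSemialgebraic ℚ s) : IsSemialgebraicFunOn ℚ s (fun _ => (0 : ℝ)) := by
  simpa using isSemialgebraicFunOn_ratCast hs 0

theorem sa_one (hs : IsSemialgebraic ℚ s) : IsSemialgebraicFunOn ℚ s (fun _ => (1 : ℝ)) := by
  simpa using isSemialgebraicFunOn_ratCast hs 1

theorem sa_two (hs : IsSemialgebraic ℚ s) : IsSemialgebraicFunOn ℚ s (fun _ => (2 : ℝ)) := by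
  simpa using isSemialgebraicFunOn_ratCast hs 2

end consts

/-- The interval `[lo, hi]` of the `t`-line (or `u`-line), written as a band over `ℝ⁰` so that it
matches the crux's domain equations DEFINITIONALLY. -/
def I (lo hi : ℝ) : Set (Fin 1 → ℝ) := KZlog.band τ₀ (fun _ => lo) (fun _ => hi)

theorem mem_I {lo hi : ℝ} {z : Fin 1 → ℝ} :
    z ∈ I lo hi ↔ lo ≤ z 0 ∧ z 0 ≤ hi := by
  simp [I, KZlog.mem_band]

theorem I_eq_Icc (lo hi : ℝ) : I lo hi = Icc (fun _ => lo) (fun _ => hi) := by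
  ext z
  simp [mem_I, Pi.le_def, Fin.forall_fin_one]

theorem isCompact_I (lo hi : ℝ) : IsCompact (I lo hi) := by
  rw [I_eq_Icc]; exact isCompact_Icc

theorem measurableSet_I (lo hi : ℝ) : MeasurableSet (I lo hi) := by
  rw [I_eq_Icc]; exact measurableSet_Icc

theorem volume_real_I {lo hi : ℝ} (h : lo ≤ hi) : volume.real (I lo hi) = hi - lo := by
  rw [I_eq_Icc, measureReal_def, Real.volume_Icc_pi_toReal (fun _ => h)]
  simp

/-- A degenerate interval is Lebesgue-null. -/
theorem volume_I_eq_zero {lo hi : ℝ} (h : hi ≤ lo) : volume (I lo hi) = 0 :=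
  measure_mono_null (fun z hz => by
    have hz' := mem_I.1 hz
    show z (Fin.last 0) = lo
    exact le_antisymm (hz'.2.trans h) hz'.1) (KZ.volume_setOf_last_eq_zero lo)

theorem sa_I {lo hi : ℝ} (hlo : IsSemialgebraicFunOn ℚ τ₀ (fun _ => lo))
    (hhi : IsSemialgebraicFunOn ℚ τ₀ (fun _ => hi)) : IsSemialgebraic ℚ (I lo hi) :=
  KZlog.isSemialgebraic_band hlo hhi

theorem sa_I01 : IsSemialgebraic ℚ (I 0 1) := sa_I (sa_zero sa_τ₀) (sa_one sa_τ₀)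
theorem sa_I12 : IsSemialgebraic ℚ (I 1 2) := sa_I (sa_one sa_τ₀) (sa_two sa_τ₀)
theorem sa_I10 : IsSemialgebraic ℚ (I 1 0) := sa_I (sa_one sa_τ₀) (sa_zero sa_τ₀)
theorem sa_I11 : IsSemialgebraic ℚ (I 1 1) := sa_I (sa_one sa_τ₀) (sa_one sa_τ₀)

/-- `[D, 0]`: the honest representation with zero integrand. -/
def zeroRep {m : ℕ} (D : Set (Fin m → ℝ)) (hD : IsSemialgebraic ℚ D) : KZ.IntegralRep m :=
  ⟨D, fun _ => 0, hD, sa_zero hD, integrableOn_zero⟩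

@[simp] theorem zeroRep_domain {m : ℕ} (D : Set (Fin m → ℝ)) (hD : IsSemialgebraic ℚ D) :
    (zeroRep D hD).domain = D := rfl

@[simp] theorem zeroRep_integrand {m : ℕ} (D : Set (Fin m → ℝ)) (hD : IsSemialgebraic ℚ D) :
    (zeroRep D hD).integrand = fun _ => 0 := rfl

@[simp] theorem value_zeroRep {m : ℕ} (D : Set (Fin m → ℝ)) (hD : IsSemialgebraic ℚ D) :
    (zeroRep D hD).value = 0 := by
  simp [KZ.IntegralRep.value]

/-- `[D, 1/u]` for `D ⊆ [1, 2]` on the `u`-line: the unfolding of `log`. -/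
def invRep (D : Set (Fin 1 → ℝ)) (hD : IsSemialgebraic ℚ D) (hsub : D ⊆ I 1 2) :
    KZ.IntegralRep 1 where
  domain := D
  integrand := fun z => 1 / z 0
  isSemialgebraic_domain := hD
  isSemialgebraicFunOn_integrand := by
    have h := isSemialgebraicFunOn_aeval_div_aeval hD (1 : MvPolynomial (Fin 1) ℚ) (X 0)
      (fun z hz => by
        have h1 := (mem_I.1 (hsub hz)).1
        simp only [aeval_X]
        exact ne_of_gt (by linarith))
    refine h.congr fun z _ => ?_
    simp
  integrableOn := by
    refine (ContinuousOn.integrableOn_compact (isCompact_I 1 2) ?_).mono_set hsub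
    exact continuousOn_const.div ((continuous_apply _).continuousOn)
      (fun z hz => ne_of_gt (lt_of_lt_of_le one_pos (mem_I.1 hz).1))

@[simp] theorem invRep_domain (D : Set (Fin 1 → ℝ)) (hD : IsSemialgebraic ℚ D) (hsub : D ⊆ I 1 2) :
    (invRep D hD hsub).domain = D := rfl

@[simp] theorem invRep_integrand (D : Set (Fin 1 → ℝ)) (hD : IsSemialgebraic ℚ D)
    (hsub : D ⊆ I 1 2) : (invRep D hD hsub).integrand = fun z => 1 / z 0 := rfl

theorem value_invRep_of_null {D : Set (Fin 1 → ℝ)} (hD : IsSemialgebraic ℚ D) (hsub : D ⊆ I 1 2)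
    (h0 : volume D = 0) : (invRep D hD hsub).value = 0 :=
  setIntegral_measure_zero _ h0

/-- `∫₁² du/u ≥ 1/2` (it is `log 2`; a lower bound is all that is needed). -/
theorem half_le_value_invRep {D : Set (Fin 1 → ℝ)} (hD : IsSemialgebraic ℚ D) (hsub : D ⊆ I 1 2)
    (hDeq : D = I 1 2) : 1 / 2 ≤ (invRep D hD hsub).value := by
  subst hDeq
  have hf : ∀ z ∈ I 1 2, (1 / 2 : ℝ) ≤ 1 / z 0 := fun z hz => by
    obtain ⟨h1, h2⟩ := mem_I.1 hz
    exact one_div_le_one_div_of_le (by linarith) h2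
  have h := setIntegral_ge_of_const_le (μ := volume) (measurableSet_I 1 2)
    (isCompact_I 1 2).measure_lt_top.ne hf (invRep (I 1 2) hD hsub).integrableOn
  rw [volume_real_I one_le_two, smul_eq_mul] at h
  show (1 / 2 : ℝ) ≤ ∫ x in I 1 2, 1 / x 0
  linarith

/-- `[[0,1], 1/(1+t)]`: the bulk term `H V'/V` for `H = 1`, `V = 1 + t` (and for `V = (1+t)/2`). -/
def r4inv : KZ.IntegralRep 1 where
  domain := I 0 1
  integrand := fun z => 1 / (1 + z 0)
  isSemialgebraic_domain := sa_I01
  isSemialgebraicFunOn_integrand := by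
    have h := isSemialgebraicFunOn_aeval_div_aeval sa_I01 (1 : MvPolynomial (Fin 1) ℚ)
      (1 + X 0)
      (fun z hz => by
        have h1 := (mem_I.1 hz).1
        simp only [map_add, map_one, aeval_X]
        exact ne_of_gt (by linarith))
    refine h.congr fun z _ => ?_
    simp
  integrableOn := by
    refine ContinuousOn.integrableOn_compact (isCompact_I 0 1) ?_
    exact continuousOn_const.div (continuousOn_const.add (continuous_apply _).continuousOn)
      (fun z hz => ne_of_gt (by have h1 := (mem_I.1 hz).1; linarith))

@[simp] theorem r4inv_domain : r4inv.domain = I 0 1 := rfl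
@[simp] theorem r4inv_integrand : r4inv.integrand = fun z => 1 / (1 + z 0) := rfl

/-- `∫₀¹ dt/(1+t) ≥ 1/2` (it is `log 2`). -/
theorem half_le_value_r4inv : 1 / 2 ≤ r4inv.value := by
  have hf : ∀ z ∈ I 0 1, (1 / 2 : ℝ) ≤ 1 / (1 + z 0) := fun z hz => by
    obtain ⟨h1, h2⟩ := mem_I.1 hz
    exact one_div_le_one_div_of_le (by linarith) (by linarith)
  have h := setIntegral_ge_of_const_le (μ := volume) (measurableSet_I 0 1)
    (isCompact_I 0 1).measure_lt_top.ne hf r4inv.integrableOn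
  rw [volume_real_I zero_le_one, smul_eq_mul] at h
  show (1 / 2 : ℝ) ≤ ∫ x in I 0 1, 1 / (1 + x 0)
  linarith

/-- Soundness, specialised to the crux's four-term shape. -/
theorem values_of_mem_relations {n : ℕ} (r₁ : KZ.IntegralRep (n + 2))
    (r₂ r₃ r₄ : KZ.IntegralRep (n + 1))
    (h : KZ.of r₁ - KZ.of r₂ + KZ.of r₃ + KZ.of r₄ ∈ KZ.relations) :
    r₁.value - r₂.value + r₃.value + r₄.value = 0 := by
  have h' := KZ.relations_le_ker_eval_holds h
  simpa [AddMonoidHom.mem_ker, map_add, map_sub, KZ.eval_of] using h'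

/-! ### The honest data used by the witnesses -/

/-- On `ℝ¹`, `Fin.snoc` over the empty tuple is the constant tuple (simp helper: Mathlib's
`Fin.snoc_last` is keyed on `Fin.last 0`, which `simp` normalises to `0`). -/
@[simp] theorem snoc_fin0 (x : Fin 0 → ℝ) (c : ℝ) : (Fin.snoc x c : Fin 1 → ℝ) 0 = c := rfl

/-- `H = t` (the band coordinate). -/
def Hcoord : (Fin 1 → ℝ) → ℝ := fun z => z 0
/-- `V = 1 + t`. -/
def Vlin : (Fin 1 → ℝ) → ℝ := fun z => 1 + z 0
/-- `V = (1 + t)/2` (positive, but `< 1` on `[0, 1)`). -/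
def Vhalf : (Fin 1 → ℝ) → ℝ := fun z => (1 + z 0) / 2
/-- The cut `{t < 1}` of the `t`-line. -/
def Cut : Set (Fin 1 → ℝ) := {z | z 0 < 1}
open Classical in
/-- The semialgebraic step `t ↦ if t < 1 then c₁ else c₂`. -/
def step (c₁ c₂ : ℝ) : (Fin 1 → ℝ) → ℝ := fun z => if z ∈ Cut then c₁ else c₂

@[simp] theorem Hcoord_apply (z : Fin 1 → ℝ) : Hcoord z = z 0 := rfl
@[simp] theorem Vlin_apply (z : Fin 1 → ℝ) : Vlin z = 1 + z 0 := rfl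
@[simp] theorem Vhalf_apply (z : Fin 1 → ℝ) : Vhalf z = (1 + z 0) / 2 := rfl
theorem mem_Cut {z : Fin 1 → ℝ} : z ∈ Cut ↔ z 0 < 1 := Iff.rfl
theorem step_of_lt {c₁ c₂ : ℝ} {z : Fin 1 → ℝ} (h : z 0 < 1) : step c₁ c₂ z = c₁ := by
  unfold step; exact if_pos h
theorem step_of_not_lt {c₁ c₂ : ℝ} {z : Fin 1 → ℝ} (h : ¬ z 0 < 1) :
    step c₁ c₂ z = c₂ := by
  unfold step; exact if_neg h

theorem sa_Hcoord {s : Set (Fin 1 → ℝ)} (hs : IsSemialgebraic ℚ s) : IsSemialgebraicFunOn ℚ s Hcoord :=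
  isSemialgebraicFunOn_apply hs 0

theorem sa_Vlin {s : Set (Fin 1 → ℝ)} (hs : IsSemialgebraic ℚ s) : IsSemialgebraicFunOn ℚ s Vlin := by
  refine (isSemialgebraicFunOn_aeval hs (1 + X 0 : MvPolynomial (Fin 1) ℚ)).congr fun z _ => ?_
  simp

theorem sa_Vhalf {s : Set (Fin 1 → ℝ)} (hs : IsSemialgebraic ℚ s) :
    IsSemialgebraicFunOn ℚ s Vhalf := by
  have h := isSemialgebraicFunOn_aeval_div_aeval hs (1 + X 0 : MvPolynomial (Fin 1) ℚ)
    (C 2) (fun z _ => by simp)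
  refine h.congr fun z _ => ?_
  simp [Vhalf]

theorem sa_Cut : IsSemialgebraic ℚ Cut :=
  sa_atom (X 0) (C 1) (fun z => by simp)

/-- Piecewise (`if … ∈ c then f else g`) of semialgebraic functions along a semialgebraic cut is
semialgebraic (union of the two half-graphs). -/
theorem sa_ite {m : ℕ} {s c : Set (Fin m → ℝ)} {f g : (Fin m → ℝ) → ℝ} [DecidablePred (· ∈ c)]
    (hc : IsSemialgebraic ℚ c) (hf : IsSemialgebraicFunOn ℚ s f) (hg : IsSemialgebraicFunOn ℚ s g) :
    IsSemialgebraicFunOn ℚ s (fun z => if z ∈ c then f z else g z) := by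
  rw [isSemialgebraicFunOn_iff] at hf hg ⊢
  have hc' : IsSemialgebraic ℚ {w : Fin (m + 1) → ℝ | Fin.init w ∈ c} := hc.setOf_init_mem
  convert (hf.inter hc').union (hg.inter hc'.compl) using 1
  ext w
  simp only [mem_setOf_eq, mem_union, mem_inter_iff, mem_compl_iff]
  by_cases h : Fin.init w ∈ c
  · simp [h]
  · simp [h]

theorem sa_step {s : Set (Fin 1 → ℝ)} {c₁ c₂ : ℝ}
    (h₁ : IsSemialgebraicFunOn ℚ s (fun _ => c₁)) (h₂ : IsSemialgebraicFunOn ℚ s (fun _ => c₂)) :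
    IsSemialgebraicFunOn ℚ s (step c₁ c₂) := by
  classical
  unfold step
  convert sa_ite sa_Cut h₁ h₂ using 3

/-- The unfolded bulk domain `{(t, u) | t ∈ D, 1 ≤ u ≤ V t}` in the `(t,u)`-plane. -/
def r1zero (D : Set (Fin 1 → ℝ)) (hD : IsSemialgebraic ℚ D) (V : (Fin 1 → ℝ) → ℝ)
    (hV : IsSemialgebraicFunOn ℚ D V) : KZ.IntegralRep 2 :=
  zeroRep (KZlog.band D (fun _ => 1) V) (KZlog.isSemialgebraic_band (sa_one hD) hV)

/-- The boundary domain `{1 ≤ u ≤ V(·, c)}` over `ℝ⁰`, written EXACTLY as the crux writes the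
domains of `r₂` (`c = b`) and `r₃` (`c = a`), so that the domain equations hold by `rfl`. -/
def Bdry (V : (Fin 1 → ℝ) → ℝ) (c : ℝ) : Set (Fin 1 → ℝ) :=
  KZlog.band τ₀ (fun _ => 1) (fun x => V (Fin.snoc x ((fun _ : Fin 0 → ℝ => c) x)))

theorem Bdry_eq_I {V : (Fin 1 → ℝ) → ℝ} {c v : ℝ} (hv : ∀ x : Fin 0 → ℝ, V (Fin.snoc x c) = v) :
    Bdry V c = I 1 v := by
  ext z
  simp [Bdry, I, KZlog.mem_band, hv]

theorem sa_Bdry {V : (Fin 1 → ℝ) → ℝ} {c v : ℝ} (hv : ∀ x : Fin 0 → ℝ, V (Fin.snoc x c) = v)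
    (hvs : IsSemialgebraicFunOn ℚ τ₀ (fun _ => v)) : IsSemialgebraic ℚ (Bdry V c) := by
  rw [Bdry_eq_I hv]; exact sa_I (sa_one sa_τ₀) hvs

theorem Bdry_subset_I12 {V : (Fin 1 → ℝ) → ℝ} {c v : ℝ} (hv : ∀ x : Fin 0 → ℝ, V (Fin.snoc x c) = v)
    (h2 : v ≤ 2) : Bdry V c ⊆ I 1 2 := by
  rw [Bdry_eq_I hv]
  intro z hz
  obtain ⟨h1, h3⟩ := mem_I.1 hz
  exact mem_I.2 ⟨h1, h3.trans h2⟩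

/-! ## §2 Load-bearing analysis: every ANALYTIC hypothesis of the crux is necessary

Method: delete one hypothesis, keep all others honest, and exhibit honest representations whose
values do not cancel; soundness (`KZ.relations_le_ker_eval_holds`) then forbids the conclusion.
The SEMIALGEBRAICITY hypotheses (`τ, a, b, H, V`) cannot be tested this way: deleting them keeps
`eval = 0` (they are not needed for soundness, only for the intermediate representations of a
derivation) — see §4. -/

/-! ### §2a `a ≤ b` is load-bearing
Witness A: `n = 0`, `a = 1 > 0 = b` (empty band), `H = t`, `H' = 1`, `V = 2`, `V' = 0`.  The band
terms `r₁, r₄` have empty domains, `r₂ = [[1,2], H(b)/u] = [[1,2], 0]`, but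
`r₃ = [[1,2], H(a)/u] = [[1,2], 1/u]` has value `log 2 > 0`: the combination evaluates to `log 2`. -/

/-- The crux with the hypothesis `∀ x ∈ τ, a x ≤ b x` DELETED. -/
def WithoutHab : Prop :=
  ∀ (n : ℕ) (τ : Set (Fin n → ℝ)) (a b : (Fin n → ℝ) → ℝ) (H H' V V' : (Fin (n + 1) → ℝ) → ℝ) (r₁ : Literature.NumberTheory.Transcendental.KZ.IntegralRep (n + 2)) (r₂ r₃ r₄ : Literature.NumberTheory.Transcendental.KZ.IntegralRep (n + 1)), Literature.ModelTheory.ExponentialFields.IsSemialgebraic ℚ τ →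
    Literature.NumberTheory.Transcendental.IsSemialgebraicFunOn ℚ τ a →
    Literature.NumberTheory.Transcendental.IsSemialgebraicFunOn ℚ τ b →
    r₄.domain = {z | (Fin.init z : Fin n → ℝ) ∈ τ ∧ a (Fin.init z) ≤ z (Fin.last n) ∧ z (Fin.last n) ≤ b (Fin.init z)} →
    Literature.NumberTheory.Transcendental.IsSemialgebraicFunOn ℚ r₄.domain H →
    Literature.NumberTheory.Transcendental.IsSemialgebraicFunOn ℚ r₄.domain V →
    (∀ z ∈ r₄.domain, 1 ≤ V z) →
    (∀ x ∈ τ, ContinuousOn (fun t : ℝ => H (Fin.snoc x t)) (Set.Icc (a x) (b x)) ∧ ContinuousOn (fun t : ℝ => V (Fin.snoc x t)) (Set.Icc (a x) (b x))) →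
    (∀ x ∈ τ, ∀ t ∈ Set.Ioo (a x) (b x), HasDerivAt (fun s : ℝ => H (Fin.snoc x s)) (H' (Fin.snoc x t)) t ∧ HasDerivAt (fun s : ℝ => V (Fin.snoc x s)) (V' (Fin.snoc x t)) t) →
    (∀ z ∈ r₄.domain, a (Fin.init z) < z (Fin.last n) → z (Fin.last n) < b (Fin.init z) → r₄.integrand z = H z * V' z / V z) →
    r₁.domain = {w | (Fin.init w : Fin (n + 1) → ℝ) ∈ r₄.domain ∧ 1 ≤ w (Fin.last (n + 1)) ∧ w (Fin.last (n + 1)) ≤ V (Fin.init w)} →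
    (∀ w ∈ r₁.domain, a (Fin.init (Fin.init w)) < Fin.init w (Fin.last n) → Fin.init w (Fin.last n) < b (Fin.init (Fin.init w)) → r₁.integrand w = H' (Fin.init w) / w (Fin.last (n + 1))) →
    r₂.domain = {z | (Fin.init z : Fin n → ℝ) ∈ τ ∧ 1 ≤ z (Fin.last n) ∧ z (Fin.last n) ≤ V (Fin.snoc (Fin.init z) (b (Fin.init z)))} →
    (∀ z ∈ r₂.domain, r₂.integrand z = H (Fin.snoc (Fin.init z) (b (Fin.init z))) / z (Fin.last n)) →
    r₃.domain = {z | (Fin.init z : Fin n → ℝ) ∈ τ ∧ 1 ≤ z (Fin.last n) ∧ z (Fin.last n) ≤ V (Fin.snoc (Fin.init z) (a (Fin.init z)))} →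
    (∀ z ∈ r₃.domain, r₃.integrand z = H (Fin.snoc (Fin.init z) (a (Fin.init z))) / z (Fin.last n)) →
    Literature.NumberTheory.Transcendental.KZ.of r₁ - Literature.NumberTheory.Transcendental.KZ.of r₂ + Literature.NumberTheory.Transcendental.KZ.of r₃ + Literature.NumberTheory.Transcendental.KZ.of r₄ ∈ Literature.NumberTheory.Transcendental.KZ.relations

namespace A

/-- `r₄ = [band, H V'/V] = [[1,0], 0]` (empty band). -/
def r₄ : KZ.IntegralRep 1 := zeroRep (I 1 0) sa_I10
/-- `r₁ = [{1 ≤ u ≤ V} over the empty band, 0]`. -/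
def r₁ : KZ.IntegralRep 2 := r1zero (I 1 0) sa_I10 (fun _ => 2) (sa_two sa_I10)
theorem hv (c : ℝ) : ∀ x : Fin 0 → ℝ, (fun _ : Fin 1 → ℝ => (2 : ℝ)) (Fin.snoc x c) = 2 := fun _ => rfl
/-- `r₂ = [{1 ≤ u ≤ V(b)}, H(b)/u] = [[1,2], 0]`. -/
def r₂ : KZ.IntegralRep 1 := zeroRep (Bdry (fun _ => 2) 0) (sa_Bdry (hv 0) (sa_two sa_τ₀))
/-- `r₃ = [{1 ≤ u ≤ V(a)}, H(a)/u] = [[1,2], 1/u]`, value `log 2`. -/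
def r₃ : KZ.IntegralRep 1 :=
  invRep (Bdry (fun _ => 2) 1) (sa_Bdry (hv 1) (sa_two sa_τ₀)) (Bdry_subset_I12 (hv 1) le_rfl)

end A

/-- **`a ≤ b` is load-bearing**: without it the crux is false (witness A). Any proof must use `hab`
(it is what makes the empty-fibre case consistent: for `b < a` the band is empty but the boundary
terms `H(a) log V(a)`, `H(b) log V(b)` need not cancel — the same soundness caveat as printed for
`KZ.newtonLeibnizRel`). -/
theorem unfoldedLogStokes_false_without_hab : ¬ WithoutHab := by
  intro h
  have hcont : ∀ x ∈ τ₀, ContinuousOn (fun t : ℝ => Hcoord (Fin.snoc x t)) (Icc 1 0) ∧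
      ContinuousOn (fun _ : ℝ => (2 : ℝ)) (Icc 1 0) := fun x _ =>
    ⟨by simp only [Hcoord_apply, snoc_fin0]; exact continuousOn_id, continuousOn_const⟩
  have hder : ∀ x ∈ τ₀, ∀ t ∈ Ioo (1 : ℝ) 0,
      HasDerivAt (fun s : ℝ => Hcoord (Fin.snoc x s)) 1 t ∧ HasDerivAt (fun _ : ℝ => (2 : ℝ)) 0 t :=
    fun x _ t _ => ⟨by simp only [Hcoord_apply, snoc_fin0]; exact hasDerivAt_id' t,
      hasDerivAt_const t 2⟩
  have hr₄ : ∀ z ∈ A.r₄.domain, (1 : ℝ) < z 0 → z 0 < 0 →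
      A.r₄.integrand z = Hcoord z * 0 / 2 := fun z _ _ _ => by simp [A.r₄]
  have hr₁ : ∀ w ∈ A.r₁.domain, (1 : ℝ) < Fin.init w 0 → Fin.init w 0 < 0 →
      A.r₁.integrand w = 1 / w (Fin.last 1) := fun w _ h1 h2 =>
    absurd (h1.trans h2) (by norm_num)
  have hr₂ : ∀ z ∈ A.r₂.domain,
      A.r₂.integrand z = Hcoord (Fin.snoc (Fin.init z) 0) / z 0 := fun z _ => by
    simp [A.r₂]
  have hr₃ : ∀ z ∈ A.r₃.domain,
      A.r₃.integrand z = Hcoord (Fin.snoc (Fin.init z) 1) / z 0 := fun z _ => by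
    simp [A.r₃]
  have key := h 0 τ₀ (fun _ => 1) (fun _ => 0) Hcoord (fun _ => 1) (fun _ => 2) (fun _ => 0)
    A.r₁ A.r₂ A.r₃ A.r₄ sa_τ₀ (sa_one sa_τ₀) (sa_zero sa_τ₀) rfl (sa_Hcoord sa_I10) (sa_two sa_I10)
    (fun z _ => by norm_num) hcont hder hr₄ rfl hr₁ rfl hr₂ rfl hr₃
  have hval := values_of_mem_relations _ _ _ _ key
  have h3 : 1 / 2 ≤ A.r₃.value := half_le_value_invRep _ _ (Bdry_eq_I (A.hv 1))
  simp only [A.r₁, A.r₂, A.r₄, r1zero, value_zeroRep] at hval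
  linarith

/-! ### Shared boundary values and the derivative of a step -/

theorem const_snoc (c d : ℝ) : ∀ x : Fin 0 → ℝ, (fun _ : Fin 1 → ℝ => d) (Fin.snoc x c) = d :=
  fun _ => rfl
theorem Vlin_snoc_one : ∀ x : Fin 0 → ℝ, Vlin (Fin.snoc x 1) = 2 := fun x => by norm_num
theorem Vlin_snoc_zero : ∀ x : Fin 0 → ℝ, Vlin (Fin.snoc x 0) = 1 := fun x => by simp
theorem Vhalf_snoc_one : ∀ x : Fin 0 → ℝ, Vhalf (Fin.snoc x 1) = 1 := fun x => by norm_num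
theorem Vhalf_snoc_zero : ∀ x : Fin 0 → ℝ, Vhalf (Fin.snoc x 0) = 1 / 2 := fun x => by simp
theorem step_snoc_one (c₁ c₂ : ℝ) : ∀ x : Fin 0 → ℝ, step c₁ c₂ (Fin.snoc x 1) = c₂ :=
  fun x => step_of_not_lt (by simp)
theorem step_snoc_zero (c₁ c₂ : ℝ) : ∀ x : Fin 0 → ℝ, step c₁ c₂ (Fin.snoc x 0) = c₁ :=
  fun x => step_of_lt (by simp)

theorem sa_half : IsSemialgebraicFunOn ℚ τ₀ (fun _ => (1 / 2 : ℝ)) := by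
  simpa using isSemialgebraicFunOn_ratCast sa_τ₀ (1 / 2)

/-- Off the jump, a step is locally constant: derivative `0` at every `t < 1`. -/
theorem hasDerivAt_step (c₁ c₂ : ℝ) {t : ℝ} (ht : t < 1) (x : Fin 0 → ℝ) :
    HasDerivAt (fun s : ℝ => step c₁ c₂ (Fin.snoc x s)) 0 t := by
  refine (hasDerivAt_const t c₁).congr_of_eventuallyEq ?_
  filter_upwards [Iio_mem_nhds ht] with s hs
  exact step_of_lt (by simpa using hs)

theorem hasDerivAt_Vlin (t : ℝ) (x : Fin 0 → ℝ) :
    HasDerivAt (fun s : ℝ => Vlin (Fin.snoc x s)) 1 t := by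
  simp only [Vlin_apply, snoc_fin0]
  exact (hasDerivAt_id' t).const_add 1

theorem hasDerivAt_Vhalf (t : ℝ) (x : Fin 0 → ℝ) :
    HasDerivAt (fun s : ℝ => Vhalf (Fin.snoc x s)) (1 / 2) t := by
  simp only [Vhalf_apply, snoc_fin0]
  exact ((hasDerivAt_id' t).const_add 1).div_const 2

theorem continuousOn_Vlin (x : Fin 0 → ℝ) (s : Set ℝ) :
    ContinuousOn (fun t : ℝ => Vlin (Fin.snoc x t)) s := by
  simp only [Vlin_apply, snoc_fin0]
  exact (continuousOn_const.add continuousOn_id)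

theorem continuousOn_Vhalf (x : Fin 0 → ℝ) (s : Set ℝ) :
    ContinuousOn (fun t : ℝ => Vhalf (Fin.snoc x t)) s := by
  simp only [Vhalf_apply, snoc_fin0]
  exact (continuousOn_const.add continuousOn_id).div_const _

theorem continuousOn_Hcoord (x : Fin 0 → ℝ) (s : Set ℝ) :
    ContinuousOn (fun t : ℝ => Hcoord (Fin.snoc x t)) s := by
  simp only [Hcoord_apply, snoc_fin0]
  exact continuousOn_id

/-! ### §2b `1 ≤ V` is load-bearing (it cannot be weakened to `0 < V`)
Witness B: `n = 0`, `[a,b] = [0,1]`, `H = 1`, `H' = 0`, `V = (1+t)/2 ∈ [1/2, 1]`, `V' = 1/2`.  The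
unfolded fibres `{1 ≤ u ≤ V}` are EMPTY (or a point), so `r₁, r₂, r₃` vanish, but the bulk term
`r₄ = [[0,1], V'/V] = [[0,1], 1/(1+t)]` has value `log 2 > 0`.  Mechanism: for `V < 1` the unfolding
`log V = ∫₁^V du/u` needs the ORIENTED interval; the honest domain `{1 ≤ u ≤ V}` silently computes
`log⁺ V` instead.  (The crux's own docstring handles `0 < V` by `log v = log max(v,1) − log max(1/v,1)`
upstream, in `LogPrimitiveNL`; the engine itself needs `1 ≤ V`.) -/

/-- The crux with `∀ z ∈ r₄.domain, 1 ≤ V z` WEAKENED to `∀ z ∈ r₄.domain, 0 < V z`. -/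
def PosV : Prop :=
  ∀ (n : ℕ) (τ : Set (Fin n → ℝ)) (a b : (Fin n → ℝ) → ℝ) (H H' V V' : (Fin (n + 1) → ℝ) → ℝ) (r₁ : Literature.NumberTheory.Transcendental.KZ.IntegralRep (n + 2)) (r₂ r₃ r₄ : Literature.NumberTheory.Transcendental.KZ.IntegralRep (n + 1)), Literature.ModelTheory.ExponentialFields.IsSemialgebraic ℚ τ →
    Literature.NumberTheory.Transcendental.IsSemialgebraicFunOn ℚ τ a →
    Literature.NumberTheory.Transcendental.IsSemialgebraicFunOn ℚ τ b →
    (∀ x ∈ τ, a x ≤ b x) →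
    r₄.domain = {z | (Fin.init z : Fin n → ℝ) ∈ τ ∧ a (Fin.init z) ≤ z (Fin.last n) ∧ z (Fin.last n) ≤ b (Fin.init z)} →
    Literature.NumberTheory.Transcendental.IsSemialgebraicFunOn ℚ r₄.domain H →
    Literature.NumberTheory.Transcendental.IsSemialgebraicFunOn ℚ r₄.domain V →
    (∀ z ∈ r₄.domain, 0 < V z) →
    (∀ x ∈ τ, ContinuousOn (fun t : ℝ => H (Fin.snoc x t)) (Set.Icc (a x) (b x)) ∧ ContinuousOn (fun t : ℝ => V (Fin.snoc x t)) (Set.Icc (a x) (b x))) →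
    (∀ x ∈ τ, ∀ t ∈ Set.Ioo (a x) (b x), HasDerivAt (fun s : ℝ => H (Fin.snoc x s)) (H' (Fin.snoc x t)) t ∧ HasDerivAt (fun s : ℝ => V (Fin.snoc x s)) (V' (Fin.snoc x t)) t) →
    (∀ z ∈ r₄.domain, a (Fin.init z) < z (Fin.last n) → z (Fin.last n) < b (Fin.init z) → r₄.integrand z = H z * V' z / V z) →
    r₁.domain = {w | (Fin.init w : Fin (n + 1) → ℝ) ∈ r₄.domain ∧ 1 ≤ w (Fin.last (n + 1)) ∧ w (Fin.last (n + 1)) ≤ V (Fin.init w)} →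
    (∀ w ∈ r₁.domain, a (Fin.init (Fin.init w)) < Fin.init w (Fin.last n) → Fin.init w (Fin.last n) < b (Fin.init (Fin.init w)) → r₁.integrand w = H' (Fin.init w) / w (Fin.last (n + 1))) →
    r₂.domain = {z | (Fin.init z : Fin n → ℝ) ∈ τ ∧ 1 ≤ z (Fin.last n) ∧ z (Fin.last n) ≤ V (Fin.snoc (Fin.init z) (b (Fin.init z)))} →
    (∀ z ∈ r₂.domain, r₂.integrand z = H (Fin.snoc (Fin.init z) (b (Fin.init z))) / z (Fin.last n)) →
    r₃.domain = {z | (Fin.init z : Fin n → ℝ) ∈ τ ∧ 1 ≤ z (Fin.last n) ∧ z (Fin.last n) ≤ V (Fin.snoc (Fin.init z) (a (Fin.init z)))} →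
    (∀ z ∈ r₃.domain, r₃.integrand z = H (Fin.snoc (Fin.init z) (a (Fin.init z))) / z (Fin.last n)) →
    Literature.NumberTheory.Transcendental.KZ.of r₁ - Literature.NumberTheory.Transcendental.KZ.of r₂ + Literature.NumberTheory.Transcendental.KZ.of r₃ + Literature.NumberTheory.Transcendental.KZ.of r₄ ∈ Literature.NumberTheory.Transcendental.KZ.relations

namespace B

/-- `r₄ = [[0,1], H V'/V] = [[0,1], 1/(1+t)]`, value `log 2`. -/
def r₄ : KZ.IntegralRep 1 := r4inv
/-- `r₁ = [{1 ≤ u ≤ (1+t)/2}, H'/u = 0]` (null domain anyway). -/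
def r₁ : KZ.IntegralRep 2 := r1zero (I 0 1) sa_I01 Vhalf (sa_Vhalf sa_I01)
/-- `r₂ = [{1 ≤ u ≤ V(1) = 1}, 1/u]` (null). -/
def r₂ : KZ.IntegralRep 1 :=
  invRep (Bdry Vhalf 1) (sa_Bdry Vhalf_snoc_one (sa_one sa_τ₀)) (Bdry_subset_I12 Vhalf_snoc_one one_le_two)
/-- `r₃ = [{1 ≤ u ≤ V(0) = 1/2}, 1/u]` (empty). -/
def r₃ : KZ.IntegralRep 1 :=
  invRep (Bdry Vhalf 0) (sa_Bdry Vhalf_snoc_zero sa_half)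
    (Bdry_subset_I12 Vhalf_snoc_zero (by norm_num))

theorem value_r₂ : r₂.value = 0 :=
  value_invRep_of_null _ _ (by rw [Bdry_eq_I Vhalf_snoc_one]; exact volume_I_eq_zero le_rfl)
theorem value_r₃ : r₃.value = 0 :=
  value_invRep_of_null _ _ (by rw [Bdry_eq_I Vhalf_snoc_zero]; exact volume_I_eq_zero (by norm_num))

end B

/-- **`1 ≤ V` is load-bearing** (and sharp as a hypothesis of the ENGINE): with `0 < V` only, the
crux is false (witness B). -/
theorem not_posV : ¬ PosV := by
  intro h
  have hVpos : ∀ z ∈ B.r₄.domain, 0 < Vhalf z := fun z hz => by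
    have h1 := (mem_I.1 hz).1
    simp only [Vhalf_apply]
    linarith
  have hcont : ∀ x ∈ τ₀, ContinuousOn (fun _ : ℝ => (1 : ℝ)) (Icc 0 1) ∧
      ContinuousOn (fun t : ℝ => Vhalf (Fin.snoc x t)) (Icc 0 1) := fun x _ =>
    ⟨continuousOn_const, continuousOn_Vhalf x _⟩
  have hder : ∀ x ∈ τ₀, ∀ t ∈ Ioo (0 : ℝ) 1,
      HasDerivAt (fun _ : ℝ => (1 : ℝ)) 0 t ∧
        HasDerivAt (fun s : ℝ => Vhalf (Fin.snoc x s)) (1 / 2) t := fun x _ t _ =>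
    ⟨hasDerivAt_const t 1, hasDerivAt_Vhalf t x⟩
  have hr₄ : ∀ z ∈ B.r₄.domain, (0 : ℝ) < z 0 → z 0 < 1 →
      B.r₄.integrand z = 1 * (1 / 2) / Vhalf z := fun z hz _ _ => by
    have h1 := (mem_I.1 hz).1
    have h2 : (1 + z 0) ≠ 0 := ne_of_gt (by linarith)
    simp only [B.r₄, r4inv_integrand, Vhalf_apply]
    field_simp
  have hr₁ : ∀ w ∈ B.r₁.domain, (0 : ℝ) < Fin.init w 0 → Fin.init w 0 < 1 →
      B.r₁.integrand w = 0 / w (Fin.last 1) := fun w _ _ _ => by simp [B.r₁, r1zero]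
  have hr₂ : ∀ z ∈ B.r₂.domain, B.r₂.integrand z = 1 / z 0 := fun z _ => by simp [B.r₂]
  have hr₃ : ∀ z ∈ B.r₃.domain, B.r₃.integrand z = 1 / z 0 := fun z _ => by simp [B.r₃]
  have key := h 0 τ₀ (fun _ => 0) (fun _ => 1) (fun _ => 1) (fun _ => 0) Vhalf (fun _ => 1 / 2)
    B.r₁ B.r₂ B.r₃ B.r₄ sa_τ₀ (sa_zero sa_τ₀) (sa_one sa_τ₀) (fun _ _ => zero_le_one) rfl
    (sa_one sa_I01) (sa_Vhalf sa_I01) hVpos hcont hder hr₄ rfl hr₁ rfl hr₂ rfl hr₃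
  have hval := values_of_mem_relations _ _ _ _ key
  have h4 : 1 / 2 ≤ B.r₄.value := half_le_value_r4inv
  rw [B.value_r₂, B.value_r₃] at hval
  simp only [B.r₁, r1zero, value_zeroRep] at hval
  linarith

/-! ### §2c continuity of `V` on the CLOSED fibre is load-bearing
Witness C: `[a,b] = [0,1]`, `H = 1`, `H' = 0`, `V = 1` on `[0,1)`, `V(1) = 2` (semialgebraic step,
differentiable with `V' = 0` on the open fibre), so `r₁ = r₃ = r₄ = 0` but
`r₂ = [{1 ≤ u ≤ V(1)}, 1/u] = log 2`.  Mechanism: the boundary term reads the endpoint VALUE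
`V(x, b x)`, the bulk reads the interior; only continuity ties them. -/

/-- The crux with the continuity of `t ↦ V (x,t)` on `[a x, b x]` DELETED (continuity of `H` kept). -/
def WithoutContV : Prop :=
  ∀ (n : ℕ) (τ : Set (Fin n → ℝ)) (a b : (Fin n → ℝ) → ℝ) (H H' V V' : (Fin (n + 1) → ℝ) → ℝ) (r₁ : Literature.NumberTheory.Transcendental.KZ.IntegralRep (n + 2)) (r₂ r₃ r₄ : Literature.NumberTheory.Transcendental.KZ.IntegralRep (n + 1)), Literature.ModelTheory.ExponentialFields.IsSemialgebraic ℚ τ →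
    Literature.NumberTheory.Transcendental.IsSemialgebraicFunOn ℚ τ a →
    Literature.NumberTheory.Transcendental.IsSemialgebraicFunOn ℚ τ b →
    (∀ x ∈ τ, a x ≤ b x) →
    r₄.domain = {z | (Fin.init z : Fin n → ℝ) ∈ τ ∧ a (Fin.init z) ≤ z (Fin.last n) ∧ z (Fin.last n) ≤ b (Fin.init z)} →
    Literature.NumberTheory.Transcendental.IsSemialgebraicFunOn ℚ r₄.domain H →
    Literature.NumberTheory.Transcendental.IsSemialgebraicFunOn ℚ r₄.domain V →
    (∀ z ∈ r₄.domain, 1 ≤ V z) →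
    (∀ x ∈ τ, ContinuousOn (fun t : ℝ => H (Fin.snoc x t)) (Set.Icc (a x) (b x))) →
    (∀ x ∈ τ, ∀ t ∈ Set.Ioo (a x) (b x), HasDerivAt (fun s : ℝ => H (Fin.snoc x s)) (H' (Fin.snoc x t)) t ∧ HasDerivAt (fun s : ℝ => V (Fin.snoc x s)) (V' (Fin.snoc x t)) t) →
    (∀ z ∈ r₄.domain, a (Fin.init z) < z (Fin.last n) → z (Fin.last n) < b (Fin.init z) → r₄.integrand z = H z * V' z / V z) →
    r₁.domain = {w | (Fin.init w : Fin (n + 1) → ℝ) ∈ r₄.domain ∧ 1 ≤ w (Fin.last (n + 1)) ∧ w (Fin.last (n + 1)) ≤ V (Fin.init w)} →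
    (∀ w ∈ r₁.domain, a (Fin.init (Fin.init w)) < Fin.init w (Fin.last n) → Fin.init w (Fin.last n) < b (Fin.init (Fin.init w)) → r₁.integrand w = H' (Fin.init w) / w (Fin.last (n + 1))) →
    r₂.domain = {z | (Fin.init z : Fin n → ℝ) ∈ τ ∧ 1 ≤ z (Fin.last n) ∧ z (Fin.last n) ≤ V (Fin.snoc (Fin.init z) (b (Fin.init z)))} →
    (∀ z ∈ r₂.domain, r₂.integrand z = H (Fin.snoc (Fin.init z) (b (Fin.init z))) / z (Fin.last n)) →
    r₃.domain = {z | (Fin.init z : Fin n → ℝ) ∈ τ ∧ 1 ≤ z (Fin.last n) ∧ z (Fin.last n) ≤ V (Fin.snoc (Fin.init z) (a (Fin.init z)))} →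
    (∀ z ∈ r₃.domain, r₃.integrand z = H (Fin.snoc (Fin.init z) (a (Fin.init z))) / z (Fin.last n)) →
    Literature.NumberTheory.Transcendental.KZ.of r₁ - Literature.NumberTheory.Transcendental.KZ.of r₂ + Literature.NumberTheory.Transcendental.KZ.of r₃ + Literature.NumberTheory.Transcendental.KZ.of r₄ ∈ Literature.NumberTheory.Transcendental.KZ.relations

namespace C

def r₄ : KZ.IntegralRep 1 := zeroRep (I 0 1) sa_I01
def r₁ : KZ.IntegralRep 2 := r1zero (I 0 1) sa_I01 (step 1 2) (sa_step (sa_one sa_I01) (sa_two sa_I01))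
/-- `r₂ = [{1 ≤ u ≤ V(1) = 2}, 1/u]`, value `log 2`. -/
def r₂ : KZ.IntegralRep 1 :=
  invRep (Bdry (step 1 2) 1) (sa_Bdry (step_snoc_one 1 2) (sa_two sa_τ₀))
    (Bdry_subset_I12 (step_snoc_one 1 2) le_rfl)
/-- `r₃ = [{1 ≤ u ≤ V(0) = 1}, 1/u]` (null). -/
def r₃ : KZ.IntegralRep 1 :=
  invRep (Bdry (step 1 2) 0) (sa_Bdry (step_snoc_zero 1 2) (sa_one sa_τ₀))
    (Bdry_subset_I12 (step_snoc_zero 1 2) one_le_two)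

theorem value_r₃ : r₃.value = 0 :=
  value_invRep_of_null _ _ (by rw [Bdry_eq_I (step_snoc_zero 1 2)]; exact volume_I_eq_zero le_rfl)

end C

/-- **Continuity of `V` up to the fibre boundary is load-bearing** (witness C). -/
theorem unfoldedLogStokes_false_without_contV : ¬ WithoutContV := by
  intro h
  have hV1 : ∀ z ∈ C.r₄.domain, 1 ≤ step 1 2 z := fun z _ => by
    unfold step; split_ifs <;> norm_num
  have hcont : ∀ x ∈ τ₀, ContinuousOn (fun _ : ℝ => (1 : ℝ)) (Icc 0 1) := fun _ _ =>
    continuousOn_const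
  have hder : ∀ x ∈ τ₀, ∀ t ∈ Ioo (0 : ℝ) 1,
      HasDerivAt (fun _ : ℝ => (1 : ℝ)) 0 t ∧
        HasDerivAt (fun s : ℝ => step 1 2 (Fin.snoc x s)) 0 t := fun x _ t ht =>
    ⟨hasDerivAt_const t 1, hasDerivAt_step 1 2 ht.2 x⟩
  have hr₄ : ∀ z ∈ C.r₄.domain, (0 : ℝ) < z 0 → z 0 < 1 →
      C.r₄.integrand z = 1 * 0 / step 1 2 z := fun z _ _ _ => by simp [C.r₄]
  have hr₁ : ∀ w ∈ C.r₁.domain, (0 : ℝ) < Fin.init w 0 → Fin.init w 0 < 1 →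
      C.r₁.integrand w = 0 / w (Fin.last 1) := fun w _ _ _ => by simp [C.r₁, r1zero]
  have hr₂ : ∀ z ∈ C.r₂.domain, C.r₂.integrand z = 1 / z 0 := fun z _ => by simp [C.r₂]
  have hr₃ : ∀ z ∈ C.r₃.domain, C.r₃.integrand z = 1 / z 0 := fun z _ => by simp [C.r₃]
  have key := h 0 τ₀ (fun _ => 0) (fun _ => 1) (fun _ => 1) (fun _ => 0) (step 1 2) (fun _ => 0)
    C.r₁ C.r₂ C.r₃ C.r₄ sa_τ₀ (sa_zero sa_τ₀) (sa_one sa_τ₀) (fun _ _ => zero_le_one) rfl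
    (sa_one sa_I01) (sa_step (sa_one sa_I01) (sa_two sa_I01)) hV1 hcont hder hr₄ rfl hr₁ rfl hr₂
    rfl hr₃
  have hval := values_of_mem_relations _ _ _ _ key
  have h2 : 1 / 2 ≤ C.r₂.value := half_le_value_invRep _ _ (Bdry_eq_I (step_snoc_one 1 2))
  rw [C.value_r₃] at hval
  simp only [C.r₁, C.r₄, r1zero, value_zeroRep] at hval
  linarith

/-! ### §2d continuity of `H` on the CLOSED fibre is load-bearing
Witness D: `[a,b] = [0,1]`, `H = 0` on `[0,1)`, `H(1) = 1` (step), `H' = 0`, `V = 1 + t`, `V' = 1`: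
`r₁ = r₃ = r₄ = 0` (on the OPEN fibre `H V'/V = 0`), `r₂ = [{1 ≤ u ≤ 2}, H(1)/u] = log 2`. -/

/-- The crux with the continuity of `t ↦ H (x,t)` on `[a x, b x]` DELETED (continuity of `V` kept). -/
def WithoutContH : Prop :=
  ∀ (n : ℕ) (τ : Set (Fin n → ℝ)) (a b : (Fin n → ℝ) → ℝ) (H H' V V' : (Fin (n + 1) → ℝ) → ℝ) (r₁ : Literature.NumberTheory.Transcendental.KZ.IntegralRep (n + 2)) (r₂ r₃ r₄ : Literature.NumberTheory.Transcendental.KZ.IntegralRep (n + 1)), Literature.ModelTheory.ExponentialFields.IsSemialgebraic ℚ τ →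
    Literature.NumberTheory.Transcendental.IsSemialgebraicFunOn ℚ τ a →
    Literature.NumberTheory.Transcendental.IsSemialgebraicFunOn ℚ τ b →
    (∀ x ∈ τ, a x ≤ b x) →
    r₄.domain = {z | (Fin.init z : Fin n → ℝ) ∈ τ ∧ a (Fin.init z) ≤ z (Fin.last n) ∧ z (Fin.last n) ≤ b (Fin.init z)} →
    Literature.NumberTheory.Transcendental.IsSemialgebraicFunOn ℚ r₄.domain H →
    Literature.NumberTheory.Transcendental.IsSemialgebraicFunOn ℚ r₄.domain V →
    (∀ z ∈ r₄.domain, 1 ≤ V z) →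
    (∀ x ∈ τ, ContinuousOn (fun t : ℝ => V (Fin.snoc x t)) (Set.Icc (a x) (b x))) →
    (∀ x ∈ τ, ∀ t ∈ Set.Ioo (a x) (b x), HasDerivAt (fun s : ℝ => H (Fin.snoc x s)) (H' (Fin.snoc x t)) t ∧ HasDerivAt (fun s : ℝ => V (Fin.snoc x s)) (V' (Fin.snoc x t)) t) →
    (∀ z ∈ r₄.domain, a (Fin.init z) < z (Fin.last n) → z (Fin.last n) < b (Fin.init z) → r₄.integrand z = H z * V' z / V z) →
    r₁.domain = {w | (Fin.init w : Fin (n + 1) → ℝ) ∈ r₄.domain ∧ 1 ≤ w (Fin.last (n + 1)) ∧ w (Fin.last (n + 1)) ≤ V (Fin.init w)} →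
    (∀ w ∈ r₁.domain, a (Fin.init (Fin.init w)) < Fin.init w (Fin.last n) → Fin.init w (Fin.last n) < b (Fin.init (Fin.init w)) → r₁.integrand w = H' (Fin.init w) / w (Fin.last (n + 1))) →
    r₂.domain = {z | (Fin.init z : Fin n → ℝ) ∈ τ ∧ 1 ≤ z (Fin.last n) ∧ z (Fin.last n) ≤ V (Fin.snoc (Fin.init z) (b (Fin.init z)))} →
    (∀ z ∈ r₂.domain, r₂.integrand z = H (Fin.snoc (Fin.init z) (b (Fin.init z))) / z (Fin.last n)) →
    r₃.domain = {z | (Fin.init z : Fin n → ℝ) ∈ τ ∧ 1 ≤ z (Fin.last n) ∧ z (Fin.last n) ≤ V (Fin.snoc (Fin.init z) (a (Fin.init z)))} →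
    (∀ z ∈ r₃.domain, r₃.integrand z = H (Fin.snoc (Fin.init z) (a (Fin.init z))) / z (Fin.last n)) →
    Literature.NumberTheory.Transcendental.KZ.of r₁ - Literature.NumberTheory.Transcendental.KZ.of r₂ + Literature.NumberTheory.Transcendental.KZ.of r₃ + Literature.NumberTheory.Transcendental.KZ.of r₄ ∈ Literature.NumberTheory.Transcendental.KZ.relations

namespace D

def r₄ : KZ.IntegralRep 1 := zeroRep (I 0 1) sa_I01
def r₁ : KZ.IntegralRep 2 := r1zero (I 0 1) sa_I01 Vlin (sa_Vlin sa_I01)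
/-- `r₂ = [{1 ≤ u ≤ V(1) = 2}, H(1)/u = 1/u]`, value `log 2`. -/
def r₂ : KZ.IntegralRep 1 :=
  invRep (Bdry Vlin 1) (sa_Bdry Vlin_snoc_one (sa_two sa_τ₀)) (Bdry_subset_I12 Vlin_snoc_one le_rfl)
/-- `r₃ = [{1 ≤ u ≤ V(0) = 1}, H(0)/u = 0]`. -/
def r₃ : KZ.IntegralRep 1 := zeroRep (Bdry Vlin 0) (sa_Bdry Vlin_snoc_zero (sa_one sa_τ₀))

end D

/-- **Continuity of `H` up to the fibre boundary is load-bearing** (witness D). -/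
theorem unfoldedLogStokes_false_without_contH : ¬ WithoutContH := by
  intro h
  have hV1 : ∀ z ∈ D.r₄.domain, 1 ≤ Vlin z := fun z hz => by
    have h1 := (mem_I.1 hz).1
    simp only [Vlin_apply]
    linarith
  have hcont : ∀ x ∈ τ₀, ContinuousOn (fun t : ℝ => Vlin (Fin.snoc x t)) (Icc 0 1) := fun x _ =>
    continuousOn_Vlin x _
  have hder : ∀ x ∈ τ₀, ∀ t ∈ Ioo (0 : ℝ) 1,
      HasDerivAt (fun s : ℝ => step 0 1 (Fin.snoc x s)) 0 t ∧
        HasDerivAt (fun s : ℝ => Vlin (Fin.snoc x s)) 1 t := fun x _ t ht =>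
    ⟨hasDerivAt_step 0 1 ht.2 x, hasDerivAt_Vlin t x⟩
  have hr₄ : ∀ z ∈ D.r₄.domain, (0 : ℝ) < z 0 → z 0 < 1 →
      D.r₄.integrand z = step 0 1 z * 1 / Vlin z := fun z _ _ h2 => by
    simp [D.r₄, step_of_lt h2]
  have hr₁ : ∀ w ∈ D.r₁.domain, (0 : ℝ) < Fin.init w 0 → Fin.init w 0 < 1 →
      D.r₁.integrand w = 0 / w (Fin.last 1) := fun w _ _ _ => by simp [D.r₁, r1zero]
  have hr₂ : ∀ z ∈ D.r₂.domain, D.r₂.integrand z = step 0 1 (Fin.snoc (Fin.init z) 1) / z 0 :=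
    fun z _ => by rw [step_snoc_one]; simp [D.r₂]
  have hr₃ : ∀ z ∈ D.r₃.domain, D.r₃.integrand z = step 0 1 (Fin.snoc (Fin.init z) 0) / z 0 :=
    fun z _ => by rw [step_snoc_zero]; simp [D.r₃]
  have key := h 0 τ₀ (fun _ => 0) (fun _ => 1) (step 0 1) (fun _ => 0) Vlin (fun _ => 1)
    D.r₁ D.r₂ D.r₃ D.r₄ sa_τ₀ (sa_zero sa_τ₀) (sa_one sa_τ₀) (fun _ _ => zero_le_one) rfl
    (sa_step (sa_zero sa_I01) (sa_one sa_I01)) (sa_Vlin sa_I01) hV1 hcont hder hr₄ rfl hr₁ rfl hr₂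
    rfl hr₃
  have hval := values_of_mem_relations _ _ _ _ key
  have h2 : 1 / 2 ≤ D.r₂.value := half_le_value_invRep _ _ (Bdry_eq_I Vlin_snoc_one)
  simp only [D.r₁, D.r₃, D.r₄, r1zero, value_zeroRep] at hval
  linarith

/-! ### §2e the derivative hypothesis for `H` is load-bearing (`H'` is otherwise a free symbol)
Witness E: `[0,1]`, `H = t`, but `H' := 0`; `V = 2`, `V' = 0`: `r₁ = r₃ = r₄ = 0`,
`r₂ = [{1 ≤ u ≤ 2}, H(1)/u] = log 2`. -/

/-- The crux with `HasDerivAt (t ↦ H (x,t)) (H' (x,t)) t` DELETED (the `V`-clause kept). -/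
def WithoutDerivH : Prop :=
  ∀ (n : ℕ) (τ : Set (Fin n → ℝ)) (a b : (Fin n → ℝ) → ℝ) (H H' V V' : (Fin (n + 1) → ℝ) → ℝ) (r₁ : Literature.NumberTheory.Transcendental.KZ.IntegralRep (n + 2)) (r₂ r₃ r₄ : Literature.NumberTheory.Transcendental.KZ.IntegralRep (n + 1)), Literature.ModelTheory.ExponentialFields.IsSemialgebraic ℚ τ →
    Literature.NumberTheory.Transcendental.IsSemialgebraicFunOn ℚ τ a →
    Literature.NumberTheory.Transcendental.IsSemialgebraicFunOn ℚ τ b →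
    (∀ x ∈ τ, a x ≤ b x) →
    r₄.domain = {z | (Fin.init z : Fin n → ℝ) ∈ τ ∧ a (Fin.init z) ≤ z (Fin.last n) ∧ z (Fin.last n) ≤ b (Fin.init z)} →
    Literature.NumberTheory.Transcendental.IsSemialgebraicFunOn ℚ r₄.domain H →
    Literature.NumberTheory.Transcendental.IsSemialgebraicFunOn ℚ r₄.domain V →
    (∀ z ∈ r₄.domain, 1 ≤ V z) →
    (∀ x ∈ τ, ContinuousOn (fun t : ℝ => H (Fin.snoc x t)) (Set.Icc (a x) (b x)) ∧ ContinuousOn (fun t : ℝ => V (Fin.snoc x t)) (Set.Icc (a x) (b x))) →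
    (∀ x ∈ τ, ∀ t ∈ Set.Ioo (a x) (b x), HasDerivAt (fun s : ℝ => V (Fin.snoc x s)) (V' (Fin.snoc x t)) t) →
    (∀ z ∈ r₄.domain, a (Fin.init z) < z (Fin.last n) → z (Fin.last n) < b (Fin.init z) → r₄.integrand z = H z * V' z / V z) →
    r₁.domain = {w | (Fin.init w : Fin (n + 1) → ℝ) ∈ r₄.domain ∧ 1 ≤ w (Fin.last (n + 1)) ∧ w (Fin.last (n + 1)) ≤ V (Fin.init w)} →
    (∀ w ∈ r₁.domain, a (Fin.init (Fin.init w)) < Fin.init w (Fin.last n) → Fin.init w (Fin.last n) < b (Fin.init (Fin.init w)) → r₁.integrand w = H' (Fin.init w) / w (Fin.last (n + 1))) →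
    r₂.domain = {z | (Fin.init z : Fin n → ℝ) ∈ τ ∧ 1 ≤ z (Fin.last n) ∧ z (Fin.last n) ≤ V (Fin.snoc (Fin.init z) (b (Fin.init z)))} →
    (∀ z ∈ r₂.domain, r₂.integrand z = H (Fin.snoc (Fin.init z) (b (Fin.init z))) / z (Fin.last n)) →
    r₃.domain = {z | (Fin.init z : Fin n → ℝ) ∈ τ ∧ 1 ≤ z (Fin.last n) ∧ z (Fin.last n) ≤ V (Fin.snoc (Fin.init z) (a (Fin.init z)))} →
    (∀ z ∈ r₃.domain, r₃.integrand z = H (Fin.snoc (Fin.init z) (a (Fin.init z))) / z (Fin.last n)) →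
    Literature.NumberTheory.Transcendental.KZ.of r₁ - Literature.NumberTheory.Transcendental.KZ.of r₂ + Literature.NumberTheory.Transcendental.KZ.of r₃ + Literature.NumberTheory.Transcendental.KZ.of r₄ ∈ Literature.NumberTheory.Transcendental.KZ.relations

namespace E

def r₄ : KZ.IntegralRep 1 := zeroRep (I 0 1) sa_I01
def r₁ : KZ.IntegralRep 2 := r1zero (I 0 1) sa_I01 (fun _ => 2) (sa_two sa_I01)
def r₂ : KZ.IntegralRep 1 :=
  invRep (Bdry (fun _ => 2) 1) (sa_Bdry (const_snoc 1 2) (sa_two sa_τ₀))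
    (Bdry_subset_I12 (const_snoc 1 2) le_rfl)
def r₃ : KZ.IntegralRep 1 := zeroRep (Bdry (fun _ => 2) 0) (sa_Bdry (const_snoc 0 2) (sa_two sa_τ₀))

end E

/-- **The `H`-derivative clause is load-bearing** (witness E). -/
theorem unfoldedLogStokes_false_without_derivH : ¬ WithoutDerivH := by
  intro h
  have hcont : ∀ x ∈ τ₀, ContinuousOn (fun t : ℝ => Hcoord (Fin.snoc x t)) (Icc 0 1) ∧
      ContinuousOn (fun _ : ℝ => (2 : ℝ)) (Icc 0 1) := fun x _ =>
    ⟨continuousOn_Hcoord x _, continuousOn_const⟩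
  have hder : ∀ x ∈ τ₀, ∀ t ∈ Ioo (0 : ℝ) 1, HasDerivAt (fun _ : ℝ => (2 : ℝ)) 0 t :=
    fun x _ t _ => hasDerivAt_const t 2
  have hr₄ : ∀ z ∈ E.r₄.domain, (0 : ℝ) < z 0 → z 0 < 1 →
      E.r₄.integrand z = Hcoord z * 0 / 2 := fun z _ _ _ => by simp [E.r₄]
  have hr₁ : ∀ w ∈ E.r₁.domain, (0 : ℝ) < Fin.init w 0 → Fin.init w 0 < 1 →
      E.r₁.integrand w = 0 / w (Fin.last 1) := fun w _ _ _ => by simp [E.r₁, r1zero]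
  have hr₂ : ∀ z ∈ E.r₂.domain, E.r₂.integrand z = Hcoord (Fin.snoc (Fin.init z) 1) / z 0 :=
    fun z _ => by simp [E.r₂]
  have hr₃ : ∀ z ∈ E.r₃.domain, E.r₃.integrand z = Hcoord (Fin.snoc (Fin.init z) 0) / z 0 :=
    fun z _ => by simp [E.r₃]
  have key := h 0 τ₀ (fun _ => 0) (fun _ => 1) Hcoord (fun _ => 0) (fun _ => 2) (fun _ => 0)
    E.r₁ E.r₂ E.r₃ E.r₄ sa_τ₀ (sa_zero sa_τ₀) (sa_one sa_τ₀) (fun _ _ => zero_le_one) rfl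
    (sa_Hcoord sa_I01) (sa_two sa_I01) (fun z _ => by norm_num) hcont hder hr₄ rfl hr₁ rfl hr₂
    rfl hr₃
  have hval := values_of_mem_relations _ _ _ _ key
  have h2 : 1 / 2 ≤ E.r₂.value := half_le_value_invRep _ _ (Bdry_eq_I (const_snoc 1 2))
  simp only [E.r₁, E.r₃, E.r₄, r1zero, value_zeroRep] at hval
  linarith

/-! ### §2f the derivative hypothesis for `V` is load-bearing (`V'` is otherwise a free symbol)
Witness F: `[0,1]`, `H = 1`, `H' = 0`, `V = 1 + t` but `V' := 0`: `r₁ = r₃ = r₄ = 0`,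
`r₂ = [{1 ≤ u ≤ 2}, 1/u] = log 2`. -/

/-- The crux with `HasDerivAt (t ↦ V (x,t)) (V' (x,t)) t` DELETED (the `H`-clause kept). -/
def WithoutDerivV : Prop :=
  ∀ (n : ℕ) (τ : Set (Fin n → ℝ)) (a b : (Fin n → ℝ) → ℝ) (H H' V V' : (Fin (n + 1) → ℝ) → ℝ) (r₁ : Literature.NumberTheory.Transcendental.KZ.IntegralRep (n + 2)) (r₂ r₃ r₄ : Literature.NumberTheory.Transcendental.KZ.IntegralRep (n + 1)), Literature.ModelTheory.ExponentialFields.IsSemialgebraic ℚ τ →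
    Literature.NumberTheory.Transcendental.IsSemialgebraicFunOn ℚ τ a →
    Literature.NumberTheory.Transcendental.IsSemialgebraicFunOn ℚ τ b →
    (∀ x ∈ τ, a x ≤ b x) →
    r₄.domain = {z | (Fin.init z : Fin n → ℝ) ∈ τ ∧ a (Fin.init z) ≤ z (Fin.last n) ∧ z (Fin.last n) ≤ b (Fin.init z)} →
    Literature.NumberTheory.Transcendental.IsSemialgebraicFunOn ℚ r₄.domain H →
    Literature.NumberTheory.Transcendental.IsSemialgebraicFunOn ℚ r₄.domain V →
    (∀ z ∈ r₄.domain, 1 ≤ V z) →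
    (∀ x ∈ τ, ContinuousOn (fun t : ℝ => H (Fin.snoc x t)) (Set.Icc (a x) (b x)) ∧ ContinuousOn (fun t : ℝ => V (Fin.snoc x t)) (Set.Icc (a x) (b x))) →
    (∀ x ∈ τ, ∀ t ∈ Set.Ioo (a x) (b x), HasDerivAt (fun s : ℝ => H (Fin.snoc x s)) (H' (Fin.snoc x t)) t) →
    (∀ z ∈ r₄.domain, a (Fin.init z) < z (Fin.last n) → z (Fin.last n) < b (Fin.init z) → r₄.integrand z = H z * V' z / V z) →
    r₁.domain = {w | (Fin.init w : Fin (n + 1) → ℝ) ∈ r₄.domain ∧ 1 ≤ w (Fin.last (n + 1)) ∧ w (Fin.last (n + 1)) ≤ V (Fin.init w)} →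
    (∀ w ∈ r₁.domain, a (Fin.init (Fin.init w)) < Fin.init w (Fin.last n) → Fin.init w (Fin.last n) < b (Fin.init (Fin.init w)) → r₁.integrand w = H' (Fin.init w) / w (Fin.last (n + 1))) →
    r₂.domain = {z | (Fin.init z : Fin n → ℝ) ∈ τ ∧ 1 ≤ z (Fin.last n) ∧ z (Fin.last n) ≤ V (Fin.snoc (Fin.init z) (b (Fin.init z)))} →
    (∀ z ∈ r₂.domain, r₂.integrand z = H (Fin.snoc (Fin.init z) (b (Fin.init z))) / z (Fin.last n)) →
    r₃.domain = {z | (Fin.init z : Fin n → ℝ) ∈ τ ∧ 1 ≤ z (Fin.last n) ∧ z (Fin.last n) ≤ V (Fin.snoc (Fin.init z) (a (Fin.init z)))} →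
    (∀ z ∈ r₃.domain, r₃.integrand z = H (Fin.snoc (Fin.init z) (a (Fin.init z))) / z (Fin.last n)) →
    Literature.NumberTheory.Transcendental.KZ.of r₁ - Literature.NumberTheory.Transcendental.KZ.of r₂ + Literature.NumberTheory.Transcendental.KZ.of r₃ + Literature.NumberTheory.Transcendental.KZ.of r₄ ∈ Literature.NumberTheory.Transcendental.KZ.relations

namespace F

def r₄ : KZ.IntegralRep 1 := zeroRep (I 0 1) sa_I01
def r₁ : KZ.IntegralRep 2 := r1zero (I 0 1) sa_I01 Vlin (sa_Vlin sa_I01)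
/-- `r₂ = [{1 ≤ u ≤ V(1) = 2}, 1/u]`, value `log 2`. -/
def r₂ : KZ.IntegralRep 1 :=
  invRep (Bdry Vlin 1) (sa_Bdry Vlin_snoc_one (sa_two sa_τ₀)) (Bdry_subset_I12 Vlin_snoc_one le_rfl)
/-- `r₃ = [{1 ≤ u ≤ V(0) = 1}, 1/u]` (null). -/
def r₃ : KZ.IntegralRep 1 :=
  invRep (Bdry Vlin 0) (sa_Bdry Vlin_snoc_zero (sa_one sa_τ₀)) (Bdry_subset_I12 Vlin_snoc_zero one_le_two)

theorem value_r₃ : r₃.value = 0 :=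
  value_invRep_of_null _ _ (by rw [Bdry_eq_I Vlin_snoc_zero]; exact volume_I_eq_zero le_rfl)
theorem half_le_value_r₂ : 1 / 2 ≤ r₂.value := half_le_value_invRep _ _ (Bdry_eq_I Vlin_snoc_one)

end F

/-- **The `V`-derivative clause is load-bearing** (witness F). -/
theorem unfoldedLogStokes_false_without_derivV : ¬ WithoutDerivV := by
  intro h
  have hV1 : ∀ z ∈ F.r₄.domain, 1 ≤ Vlin z := fun z hz => by
    have h1 := (mem_I.1 hz).1
    simp only [Vlin_apply]
    linarith
  have hcont : ∀ x ∈ τ₀, ContinuousOn (fun _ : ℝ => (1 : ℝ)) (Icc 0 1) ∧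
      ContinuousOn (fun t : ℝ => Vlin (Fin.snoc x t)) (Icc 0 1) := fun x _ =>
    ⟨continuousOn_const, continuousOn_Vlin x _⟩
  have hder : ∀ x ∈ τ₀, ∀ t ∈ Ioo (0 : ℝ) 1, HasDerivAt (fun _ : ℝ => (1 : ℝ)) 0 t :=
    fun x _ t _ => hasDerivAt_const t 1
  have hr₄ : ∀ z ∈ F.r₄.domain, (0 : ℝ) < z 0 → z 0 < 1 →
      F.r₄.integrand z = 1 * 0 / Vlin z := fun z _ _ _ => by simp [F.r₄]
  have hr₁ : ∀ w ∈ F.r₁.domain, (0 : ℝ) < Fin.init w 0 → Fin.init w 0 < 1 →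
      F.r₁.integrand w = 0 / w (Fin.last 1) := fun w _ _ _ => by simp [F.r₁, r1zero]
  have hr₂ : ∀ z ∈ F.r₂.domain, F.r₂.integrand z = 1 / z 0 := fun z _ => by simp [F.r₂]
  have hr₃ : ∀ z ∈ F.r₃.domain, F.r₃.integrand z = 1 / z 0 := fun z _ => by simp [F.r₃]
  have key := h 0 τ₀ (fun _ => 0) (fun _ => 1) (fun _ => 1) (fun _ => 0) Vlin (fun _ => 0)
    F.r₁ F.r₂ F.r₃ F.r₄ sa_τ₀ (sa_zero sa_τ₀) (sa_one sa_τ₀) (fun _ _ => zero_le_one) rfl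
    (sa_one sa_I01) (sa_Vlin sa_I01) hV1 hcont hder hr₄ rfl hr₁ rfl hr₂ rfl hr₃
  have hval := values_of_mem_relations _ _ _ _ key
  have h2 := F.half_le_value_r₂
  rw [F.value_r₃] at hval
  simp only [F.r₁, F.r₄, r1zero, value_zeroRep] at hval
  linarith

/-! ## §3 Refuted natural strengthenings (honest data, wrong conclusions)

Witness G = the HONEST instance `[a,b] = [0,1]`, `H = 1`, `H' = 0`, `V = 1 + t`, `V' = 1`:
`r₁ = [{1 ≤ u ≤ 1+t}, 0]`, `r₂ = [[1,2], 1/u] = log 2`, `r₃ = [[1,1], 1/u] = 0`,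
`r₄ = [[0,1], 1/(1+t)] = log 2`; the crux's combination `r₁ − r₂ + r₃ + r₄ = 0 − log 2 + 0 + log 2`
vanishes, and NO OTHER sign pattern / sub-combination below does. -/

/-- Strengthening "the bulk alone is a relation": `[r₁] + [r₄] ∈ relations`. -/
def Bulk : Prop :=
  ∀ (n : ℕ) (τ : Set (Fin n → ℝ)) (a b : (Fin n → ℝ) → ℝ) (H H' V V' : (Fin (n + 1) → ℝ) → ℝ) (r₁ : Literature.NumberTheory.Transcendental.KZ.IntegralRep (n + 2)) (r₂ r₃ r₄ : Literature.NumberTheory.Transcendental.KZ.IntegralRep (n + 1)), Literature.ModelTheory.ExponentialFields.IsSemialgebraic ℚ τ →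
    Literature.NumberTheory.Transcendental.IsSemialgebraicFunOn ℚ τ a →
    Literature.NumberTheory.Transcendental.IsSemialgebraicFunOn ℚ τ b →
    (∀ x ∈ τ, a x ≤ b x) →
    r₄.domain = {z | (Fin.init z : Fin n → ℝ) ∈ τ ∧ a (Fin.init z) ≤ z (Fin.last n) ∧ z (Fin.last n) ≤ b (Fin.init z)} →
    Literature.NumberTheory.Transcendental.IsSemialgebraicFunOn ℚ r₄.domain H →
    Literature.NumberTheory.Transcendental.IsSemialgebraicFunOn ℚ r₄.domain V →
    (∀ z ∈ r₄.domain, 1 ≤ V z) →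
    (∀ x ∈ τ, ContinuousOn (fun t : ℝ => H (Fin.snoc x t)) (Set.Icc (a x) (b x)) ∧ ContinuousOn (fun t : ℝ => V (Fin.snoc x t)) (Set.Icc (a x) (b x))) →
    (∀ x ∈ τ, ∀ t ∈ Set.Ioo (a x) (b x), HasDerivAt (fun s : ℝ => H (Fin.snoc x s)) (H' (Fin.snoc x t)) t ∧ HasDerivAt (fun s : ℝ => V (Fin.snoc x s)) (V' (Fin.snoc x t)) t) →
    (∀ z ∈ r₄.domain, a (Fin.init z) < z (Fin.last n) → z (Fin.last n) < b (Fin.init z) → r₄.integrand z = H z * V' z / V z) →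
    r₁.domain = {w | (Fin.init w : Fin (n + 1) → ℝ) ∈ r₄.domain ∧ 1 ≤ w (Fin.last (n + 1)) ∧ w (Fin.last (n + 1)) ≤ V (Fin.init w)} →
    (∀ w ∈ r₁.domain, a (Fin.init (Fin.init w)) < Fin.init w (Fin.last n) → Fin.init w (Fin.last n) < b (Fin.init (Fin.init w)) → r₁.integrand w = H' (Fin.init w) / w (Fin.last (n + 1))) →
    r₂.domain = {z | (Fin.init z : Fin n → ℝ) ∈ τ ∧ 1 ≤ z (Fin.last n) ∧ z (Fin.last n) ≤ V (Fin.snoc (Fin.init z) (b (Fin.init z)))} →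
    (∀ z ∈ r₂.domain, r₂.integrand z = H (Fin.snoc (Fin.init z) (b (Fin.init z))) / z (Fin.last n)) →
    r₃.domain = {z | (Fin.init z : Fin n → ℝ) ∈ τ ∧ 1 ≤ z (Fin.last n) ∧ z (Fin.last n) ≤ V (Fin.snoc (Fin.init z) (a (Fin.init z)))} →
    (∀ z ∈ r₃.domain, r₃.integrand z = H (Fin.snoc (Fin.init z) (a (Fin.init z))) / z (Fin.last n)) →
    Literature.NumberTheory.Transcendental.KZ.of r₁ + Literature.NumberTheory.Transcendental.KZ.of r₄ ∈ Literature.NumberTheory.Transcendental.KZ.relations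

/-- Strengthening "the boundary alone is a relation": `[r₃] − [r₂] ∈ relations`. -/
def Boundary : Prop :=
  ∀ (n : ℕ) (τ : Set (Fin n → ℝ)) (a b : (Fin n → ℝ) → ℝ) (H H' V V' : (Fin (n + 1) → ℝ) → ℝ) (r₁ : Literature.NumberTheory.Transcendental.KZ.IntegralRep (n + 2)) (r₂ r₃ r₄ : Literature.NumberTheory.Transcendental.KZ.IntegralRep (n + 1)), Literature.ModelTheory.ExponentialFields.IsSemialgebraic ℚ τ →
    Literature.NumberTheory.Transcendental.IsSemialgebraicFunOn ℚ τ a →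
    Literature.NumberTheory.Transcendental.IsSemialgebraicFunOn ℚ τ b →
    (∀ x ∈ τ, a x ≤ b x) →
    r₄.domain = {z | (Fin.init z : Fin n → ℝ) ∈ τ ∧ a (Fin.init z) ≤ z (Fin.last n) ∧ z (Fin.last n) ≤ b (Fin.init z)} →
    Literature.NumberTheory.Transcendental.IsSemialgebraicFunOn ℚ r₄.domain H →
    Literature.NumberTheory.Transcendental.IsSemialgebraicFunOn ℚ r₄.domain V →
    (∀ z ∈ r₄.domain, 1 ≤ V z) →
    (∀ x ∈ τ, ContinuousOn (fun t : ℝ => H (Fin.snoc x t)) (Set.Icc (a x) (b x)) ∧ ContinuousOn (fun t : ℝ => V (Fin.snoc x t)) (Set.Icc (a x) (b x))) →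
    (∀ x ∈ τ, ∀ t ∈ Set.Ioo (a x) (b x), HasDerivAt (fun s : ℝ => H (Fin.snoc x s)) (H' (Fin.snoc x t)) t ∧ HasDerivAt (fun s : ℝ => V (Fin.snoc x s)) (V' (Fin.snoc x t)) t) →
    (∀ z ∈ r₄.domain, a (Fin.init z) < z (Fin.last n) → z (Fin.last n) < b (Fin.init z) → r₄.integrand z = H z * V' z / V z) →
    r₁.domain = {w | (Fin.init w : Fin (n + 1) → ℝ) ∈ r₄.domain ∧ 1 ≤ w (Fin.last (n + 1)) ∧ w (Fin.last (n + 1)) ≤ V (Fin.init w)} →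
    (∀ w ∈ r₁.domain, a (Fin.init (Fin.init w)) < Fin.init w (Fin.last n) → Fin.init w (Fin.last n) < b (Fin.init (Fin.init w)) → r₁.integrand w = H' (Fin.init w) / w (Fin.last (n + 1))) →
    r₂.domain = {z | (Fin.init z : Fin n → ℝ) ∈ τ ∧ 1 ≤ z (Fin.last n) ∧ z (Fin.last n) ≤ V (Fin.snoc (Fin.init z) (b (Fin.init z)))} →
    (∀ z ∈ r₂.domain, r₂.integrand z = H (Fin.snoc (Fin.init z) (b (Fin.init z))) / z (Fin.last n)) →
    r₃.domain = {z | (Fin.init z : Fin n → ℝ) ∈ τ ∧ 1 ≤ z (Fin.last n) ∧ z (Fin.last n) ≤ V (Fin.snoc (Fin.init z) (a (Fin.init z)))} →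
    (∀ z ∈ r₃.domain, r₃.integrand z = H (Fin.snoc (Fin.init z) (a (Fin.init z))) / z (Fin.last n)) →
    Literature.NumberTheory.Transcendental.KZ.of r₃ - Literature.NumberTheory.Transcendental.KZ.of r₂ ∈ Literature.NumberTheory.Transcendental.KZ.relations

/-- The opposite orientation of the boundary: `[r₁] + [r₂] − [r₃] + [r₄] ∈ relations`. -/
def WrongSign : Prop :=
  ∀ (n : ℕ) (τ : Set (Fin n → ℝ)) (a b : (Fin n → ℝ) → ℝ) (H H' V V' : (Fin (n + 1) → ℝ) → ℝ) (r₁ : Literature.NumberTheory.Transcendental.KZ.IntegralRep (n + 2)) (r₂ r₃ r₄ : Literature.NumberTheory.Transcendental.KZ.IntegralRep (n + 1)), Literature.ModelTheory.ExponentialFields.IsSemialgebraic ℚ τ →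
    Literature.NumberTheory.Transcendental.IsSemialgebraicFunOn ℚ τ a →
    Literature.NumberTheory.Transcendental.IsSemialgebraicFunOn ℚ τ b →
    (∀ x ∈ τ, a x ≤ b x) →
    r₄.domain = {z | (Fin.init z : Fin n → ℝ) ∈ τ ∧ a (Fin.init z) ≤ z (Fin.last n) ∧ z (Fin.last n) ≤ b (Fin.init z)} →
    Literature.NumberTheory.Transcendental.IsSemialgebraicFunOn ℚ r₄.domain H →
    Literature.NumberTheory.Transcendental.IsSemialgebraicFunOn ℚ r₄.domain V →
    (∀ z ∈ r₄.domain, 1 ≤ V z) →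
    (∀ x ∈ τ, ContinuousOn (fun t : ℝ => H (Fin.snoc x t)) (Set.Icc (a x) (b x)) ∧ ContinuousOn (fun t : ℝ => V (Fin.snoc x t)) (Set.Icc (a x) (b x))) →
    (∀ x ∈ τ, ∀ t ∈ Set.Ioo (a x) (b x), HasDerivAt (fun s : ℝ => H (Fin.snoc x s)) (H' (Fin.snoc x t)) t ∧ HasDerivAt (fun s : ℝ => V (Fin.snoc x s)) (V' (Fin.snoc x t)) t) →
    (∀ z ∈ r₄.domain, a (Fin.init z) < z (Fin.last n) → z (Fin.last n) < b (Fin.init z) → r₄.integrand z = H z * V' z / V z) →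
    r₁.domain = {w | (Fin.init w : Fin (n + 1) → ℝ) ∈ r₄.domain ∧ 1 ≤ w (Fin.last (n + 1)) ∧ w (Fin.last (n + 1)) ≤ V (Fin.init w)} →
    (∀ w ∈ r₁.domain, a (Fin.init (Fin.init w)) < Fin.init w (Fin.last n) → Fin.init w (Fin.last n) < b (Fin.init (Fin.init w)) → r₁.integrand w = H' (Fin.init w) / w (Fin.last (n + 1))) →
    r₂.domain = {z | (Fin.init z : Fin n → ℝ) ∈ τ ∧ 1 ≤ z (Fin.last n) ∧ z (Fin.last n) ≤ V (Fin.snoc (Fin.init z) (b (Fin.init z)))} →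
    (∀ z ∈ r₂.domain, r₂.integrand z = H (Fin.snoc (Fin.init z) (b (Fin.init z))) / z (Fin.last n)) →
    r₃.domain = {z | (Fin.init z : Fin n → ℝ) ∈ τ ∧ 1 ≤ z (Fin.last n) ∧ z (Fin.last n) ≤ V (Fin.snoc (Fin.init z) (a (Fin.init z)))} →
    (∀ z ∈ r₃.domain, r₃.integrand z = H (Fin.snoc (Fin.init z) (a (Fin.init z))) / z (Fin.last n)) →
    Literature.NumberTheory.Transcendental.KZ.of r₁ + Literature.NumberTheory.Transcendental.KZ.of r₂ - Literature.NumberTheory.Transcendental.KZ.of r₃ + Literature.NumberTheory.Transcendental.KZ.of r₄ ∈ Literature.NumberTheory.Transcendental.KZ.relations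

namespace G

def r₄ : KZ.IntegralRep 1 := r4inv
def r₁ : KZ.IntegralRep 2 := F.r₁
def r₂ : KZ.IntegralRep 1 := F.r₂
def r₃ : KZ.IntegralRep 1 := F.r₃

/-- All hypotheses of the crux hold for witness G; any conclusion `P r₁ r₂ r₃ r₄` quantified exactly
like the crux therefore specialises to G. -/
theorem spec {P : ∀ {n : ℕ}, KZ.IntegralRep (n + 2) → KZ.IntegralRep (n + 1) → KZ.IntegralRep (n + 1) →
      KZ.IntegralRep (n + 1) → Prop}
    (h : ∀ (n : ℕ) (τ : Set (Fin n → ℝ)) (a b : (Fin n → ℝ) → ℝ) (H H' V V' : (Fin (n + 1) → ℝ) → ℝ) (r₁ : Literature.NumberTheory.Transcendental.KZ.IntegralRep (n + 2)) (r₂ r₃ r₄ : Literature.NumberTheory.Transcendental.KZ.IntegralRep (n + 1)), Literature.ModelTheory.ExponentialFields.IsSemialgebraic ℚ τ →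
      Literature.NumberTheory.Transcendental.IsSemialgebraicFunOn ℚ τ a →
      Literature.NumberTheory.Transcendental.IsSemialgebraicFunOn ℚ τ b →
      (∀ x ∈ τ, a x ≤ b x) →
      r₄.domain = {z | (Fin.init z : Fin n → ℝ) ∈ τ ∧ a (Fin.init z) ≤ z (Fin.last n) ∧ z (Fin.last n) ≤ b (Fin.init z)} →
      Literature.NumberTheory.Transcendental.IsSemialgebraicFunOn ℚ r₄.domain H →
      Literature.NumberTheory.Transcendental.IsSemialgebraicFunOn ℚ r₄.domain V →
      (∀ z ∈ r₄.domain, 1 ≤ V z) →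
      (∀ x ∈ τ, ContinuousOn (fun t : ℝ => H (Fin.snoc x t)) (Set.Icc (a x) (b x)) ∧ ContinuousOn (fun t : ℝ => V (Fin.snoc x t)) (Set.Icc (a x) (b x))) →
      (∀ x ∈ τ, ∀ t ∈ Set.Ioo (a x) (b x), HasDerivAt (fun s : ℝ => H (Fin.snoc x s)) (H' (Fin.snoc x t)) t ∧ HasDerivAt (fun s : ℝ => V (Fin.snoc x s)) (V' (Fin.snoc x t)) t) →
      (∀ z ∈ r₄.domain, a (Fin.init z) < z (Fin.last n) → z (Fin.last n) < b (Fin.init z) → r₄.integrand z = H z * V' z / V z) →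
      r₁.domain = {w | (Fin.init w : Fin (n + 1) → ℝ) ∈ r₄.domain ∧ 1 ≤ w (Fin.last (n + 1)) ∧ w (Fin.last (n + 1)) ≤ V (Fin.init w)} →
      (∀ w ∈ r₁.domain, a (Fin.init (Fin.init w)) < Fin.init w (Fin.last n) → Fin.init w (Fin.last n) < b (Fin.init (Fin.init w)) → r₁.integrand w = H' (Fin.init w) / w (Fin.last (n + 1))) →
      r₂.domain = {z | (Fin.init z : Fin n → ℝ) ∈ τ ∧ 1 ≤ z (Fin.last n) ∧ z (Fin.last n) ≤ V (Fin.snoc (Fin.init z) (b (Fin.init z)))} →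
      (∀ z ∈ r₂.domain, r₂.integrand z = H (Fin.snoc (Fin.init z) (b (Fin.init z))) / z (Fin.last n)) →
      r₃.domain = {z | (Fin.init z : Fin n → ℝ) ∈ τ ∧ 1 ≤ z (Fin.last n) ∧ z (Fin.last n) ≤ V (Fin.snoc (Fin.init z) (a (Fin.init z)))} →
      (∀ z ∈ r₃.domain, r₃.integrand z = H (Fin.snoc (Fin.init z) (a (Fin.init z))) / z (Fin.last n)) →
      P r₁ r₂ r₃ r₄) : P r₁ r₂ r₃ r₄ := by
  have hV1 : ∀ z ∈ r₄.domain, 1 ≤ Vlin z := fun z hz => by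
    have h1 := (mem_I.1 hz).1
    simp only [Vlin_apply]
    linarith
  have hcont : ∀ x ∈ τ₀, ContinuousOn (fun _ : ℝ => (1 : ℝ)) (Icc 0 1) ∧
      ContinuousOn (fun t : ℝ => Vlin (Fin.snoc x t)) (Icc 0 1) := fun x _ =>
    ⟨continuousOn_const, continuousOn_Vlin x _⟩
  have hder : ∀ x ∈ τ₀, ∀ t ∈ Ioo (0 : ℝ) 1, HasDerivAt (fun _ : ℝ => (1 : ℝ)) 0 t ∧
      HasDerivAt (fun s : ℝ => Vlin (Fin.snoc x s)) 1 t :=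
    fun x _ t _ => ⟨hasDerivAt_const t 1, hasDerivAt_Vlin t x⟩
  have hr₄ : ∀ z ∈ r₄.domain, (0 : ℝ) < z 0 → z 0 < 1 →
      r₄.integrand z = 1 * 1 / Vlin z := fun z _ _ _ => by simp [r₄]
  have hr₁ : ∀ w ∈ r₁.domain, (0 : ℝ) < Fin.init w 0 → Fin.init w 0 < 1 →
      r₁.integrand w = 0 / w (Fin.last 1) := fun w _ _ _ => by simp [r₁, F.r₁, r1zero]
  have hr₂ : ∀ z ∈ r₂.domain, r₂.integrand z = 1 / z 0 := fun z _ => by simp [r₂, F.r₂]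
  have hr₃ : ∀ z ∈ r₃.domain, r₃.integrand z = 1 / z 0 := fun z _ => by simp [r₃, F.r₃]
  exact h 0 τ₀ (fun _ => 0) (fun _ => 1) (fun _ => 1) (fun _ => 0) Vlin (fun _ => 1)
    r₁ r₂ r₃ r₄ sa_τ₀ (sa_zero sa_τ₀) (sa_one sa_τ₀) (fun _ _ => zero_le_one) rfl
    (sa_one sa_I01) (sa_Vlin sa_I01) hV1 hcont hder hr₄ rfl hr₁ rfl hr₂ rfl hr₃

theorem value_r₁ : r₁.value = 0 := by simp [r₁, F.r₁, r1zero]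
theorem value_r₃ : r₃.value = 0 := F.value_r₃
theorem half_le_value_r₂ : 1 / 2 ≤ r₂.value := F.half_le_value_r₂
theorem half_le_value_r₄ : 1 / 2 ≤ r₄.value := half_le_value_r4inv

/-- Sanity: on the honest witness the crux's own combination DOES evaluate to zero
(`0 − log 2 + 0 + log 2`), so G is not a counterexample to the crux — only to its variants. -/
theorem value_r₂_eq_value_r₄ : r₂.value = r₄.value := by
  -- both are `log 2`: `∫₁² du/u` and `∫₀¹ dt/(1+t)`; we identify them through the `u = 1 + t` shift
  -- performed at the level of one-variable integrals.
  have e := MeasureTheory.volume_preserving_funUnique (Fin 1) ℝ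
  have h₂ : r₂.value = ∫ u in Icc (1:ℝ) 2, 1 / u := by
    have hpre : r₂.domain = MeasurableEquiv.funUnique (Fin 1) ℝ ⁻¹' Icc 1 2 := by
      ext z
      show z ∈ Bdry Vlin 1 ↔ _
      rw [Bdry_eq_I Vlin_snoc_one]
      simp [mem_I, MeasurableEquiv.funUnique, Fin.default_eq_zero]
    show ∫ z in r₂.domain, r₂.integrand z = _
    rw [hpre, ← e.setIntegral_preimage_emb (MeasurableEquiv.measurableEmbedding _)]
    rfl
  have h₄ : r₄.value = ∫ t in Icc (0:ℝ) 1, 1 / (1 + t) := by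
    have hpre : r₄.domain = MeasurableEquiv.funUnique (Fin 1) ℝ ⁻¹' Icc 0 1 := by
      ext z
      show z ∈ I 0 1 ↔ _
      simp [mem_I, MeasurableEquiv.funUnique, Fin.default_eq_zero]
    show ∫ z in r₄.domain, r₄.integrand z = _
    rw [hpre, ← e.setIntegral_preimage_emb (MeasurableEquiv.measurableEmbedding _)]
    rfl
  rw [h₂, h₄, integral_Icc_eq_integral_Ioc, integral_Icc_eq_integral_Ioc,
    ← intervalIntegral.integral_of_le one_le_two, ← intervalIntegral.integral_of_le zero_le_one]
  have key := intervalIntegral.integral_comp_add_left (fun u : ℝ => 1 / u) (1 : ℝ) (a := 0) (b := 1)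
  rw [add_zero, show (1 : ℝ) + 1 = 2 by norm_num] at key
  exact key.symm

end G

/-- **The bulk terms alone are not a relation** (`[r₁] + [r₄]` evaluates to `∫_τ [H log V]_a^b`). -/
theorem not_bulk : ¬ Bulk := by
  intro h
  have key : KZ.of G.r₁ + KZ.of G.r₄ ∈ KZ.relations := G.spec (P := fun {_} r₁ _ _ r₄ =>
    KZ.of r₁ + KZ.of r₄ ∈ KZ.relations) h
  have h0 := KZ.relations_le_ker_eval_holds key
  simp only [AddMonoidHom.mem_ker, map_add, KZ.eval_of, G.value_r₁] at h0
  linarith [G.half_le_value_r₄]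

/-- **The boundary terms alone are not a relation.** -/
theorem not_boundary : ¬ Boundary := by
  intro h
  have key : KZ.of G.r₃ - KZ.of G.r₂ ∈ KZ.relations := G.spec (P := fun {_} _ r₂ r₃ _ =>
    KZ.of r₃ - KZ.of r₂ ∈ KZ.relations) h
  have h0 := KZ.relations_le_ker_eval_holds key
  simp only [AddMonoidHom.mem_ker, map_sub, KZ.eval_of, G.value_r₃] at h0
  linarith [G.half_le_value_r₂]

/-- **Orientation check**: the boundary enters as `−[r₂] + [r₃]` (value at `b` minus value at `a`,
moved to the left-hand side); the opposite sign is refuted. -/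
theorem not_wrongSign : ¬ WrongSign := by
  intro h
  have key : KZ.of G.r₁ + KZ.of G.r₂ - KZ.of G.r₃ + KZ.of G.r₄ ∈ KZ.relations :=
    G.spec (P := fun {_} r₁ r₂ r₃ r₄ => KZ.of r₁ + KZ.of r₂ - KZ.of r₃ + KZ.of r₄ ∈ KZ.relations) h
  have h0 := KZ.relations_le_ker_eval_holds key
  simp only [AddMonoidHom.mem_ker, map_add, map_sub, KZ.eval_of, G.value_r₁, G.value_r₃] at h0
  linarith [G.half_le_value_r₂, G.half_le_value_r₄]

/-! ## §4 The crux HOLDS — glue to the tree theorem `KZ.unfoldedLogStokes_mem_relations`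

Positive by-product of the disproof attempt (the strongest form of "resists"): a complete proof of
`UnfoldedLogStokes` from constants that are all in tree.  NOT landed by the refuter (Theorems/ is
prover-only for positive results); attached to the item as candidate-proof evidence.  The glue:
(a) `H'`, `V'` are only fibre derivatives on OPEN fibres — extend them by zero off the open band
(`dExt`); they are semialgebraic there by `IsSemialgebraicFunOn.hasDerivAt_last_isSemialgebraic_holds`
(Basu–Pollack–Roy Prop. 3.22, proved in tree) and glue with `0` on the two edge graphs;
(b) `r₄`, `r₁` are pinned only at interior `t` — replace them by honest twins `RB`, `W` agreeing on a
semialgebraic subset of full measure (`of_sub_of_mem_relations_of_eqOn_of_null`);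
(c) the integrability hypotheses of the tree theorem are READ OFF `r₁, r₂, r₃ : KZ.IntegralRep` by
Tonelli along the last coordinate (`integrableOn_of_lintegral_fibre_ge`, converse bookkeeping to
`KZlog.integrableOn_band_of_lintegral_fibre_le`, with the exact fibre integral
`KZlog.lintegral_enorm_div_Icc_one : ∫⁻_{[1,v]} ‖c/u‖ₑ = ‖c log v‖ₑ`);
(d) `x ↦ H(x, b x)` etc. are semialgebraic by composition (Tarski–Seidenberg, in tree);
(e) `Ub := r₂`, `Ua := r₃.neg`. -/

section Positive

variable {n : ℕ}

/-- The open band `{(x,t) | x ∈ τ, a x < t < b x}` — where the crux pins the integrands of `r₄`, `r₁`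
(written as in `SemialgebraicDerivative.lean`). -/
def openBand (τ : Set (Fin n → ℝ)) (a b : (Fin n → ℝ) → ℝ) : Set (Fin (n + 1) → ℝ) :=
  {z | Fin.init z ∈ τ ∧ a (Fin.init z) < z (Fin.last n) ∧ z (Fin.last n) < b (Fin.init z)}

/-- Fibrewise membership in the open band. [folklore] -/
theorem snoc_mem_openBand {τ : Set (Fin n → ℝ)} {a b : (Fin n → ℝ) → ℝ} {x : Fin n → ℝ} {t : ℝ} :
    (Fin.snoc x t : Fin (n + 1) → ℝ) ∈ openBand τ a b ↔ x ∈ τ ∧ t ∈ Ioo (a x) (b x) := by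
  simp [openBand, mem_Ioo]

/-- The open band lies in the closed band. [folklore] -/
theorem openBand_subset_band {τ : Set (Fin n → ℝ)} {a b : (Fin n → ℝ) → ℝ} :
    openBand τ a b ⊆ KZlog.band τ a b := fun _ hz => ⟨hz.1, hz.2.1.le, hz.2.2.le⟩

/-- Off the open band, a band point lies on one of the two edge graphs. -/
theorem band_diff_openBand_subset {τ : Set (Fin n → ℝ)} {a b : (Fin n → ℝ) → ℝ} :
    KZlog.band τ a b \ openBand τ a b ⊆
      {z | Fin.init z ∈ τ ∧ z (Fin.last n) = a (Fin.init z)} ∪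
        {z | Fin.init z ∈ τ ∧ z (Fin.last n) = b (Fin.init z)} := by
  rintro z ⟨⟨hτ, ha, hb⟩, hno⟩
  by_cases h : a (Fin.init z) < z (Fin.last n)
  · refine Or.inr ⟨hτ, le_antisymm hb (not_lt.1 fun h' => hno ⟨hτ, h, h'⟩)⟩
  · exact Or.inl ⟨hτ, le_antisymm (not_lt.1 h) ha⟩

/-- The closed band minus the open band is Lebesgue-null (two graphs). -/
theorem volume_band_diff_openBand {τ : Set (Fin n → ℝ)} {a b : (Fin n → ℝ) → ℝ}
    (ha : IsSemialgebraicFunOn ℚ τ a) (hb : IsSemialgebraicFunOn ℚ τ b) :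
    volume (KZlog.band τ a b \ openBand τ a b) = 0 :=
  measure_mono_null band_diff_openBand_subset
    (measure_union_null (KZ.volume_graph_eq_zero ha) (KZ.volume_graph_eq_zero hb))

/-- The closed band minus the two edge graphs is the open band. [folklore] -/
theorem band_diff_graphs_eq_openBand {τ : Set (Fin n → ℝ)} {a b : (Fin n → ℝ) → ℝ} :
    KZlog.band τ a b \ ({z | Fin.init z ∈ τ ∧ z (Fin.last n) = a (Fin.init z)} ∪
      {z | Fin.init z ∈ τ ∧ z (Fin.last n) = b (Fin.init z)}) = openBand τ a b := by
  ext z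
  simp only [KZlog.mem_band, openBand, Set.mem_sdiff, mem_union, mem_setOf_eq]
  constructor
  · rintro ⟨⟨hτ, ha, hb⟩, hno⟩
    exact ⟨hτ, lt_of_le_of_ne ha (fun h => hno (Or.inl ⟨hτ, h.symm⟩)),
      lt_of_le_of_ne hb (fun h => hno (Or.inr ⟨hτ, h⟩))⟩
  · rintro ⟨hτ, ha, hb⟩
    exact ⟨⟨hτ, ha.le, hb.le⟩, fun h => h.elim (fun h => ha.ne' h.2) (fun h => hb.ne h.2)⟩

/-- The open band is semialgebraic (closed band minus the two edge graphs; no Tarski–Seidenberg). -/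
theorem isSemialgebraic_openBand {τ : Set (Fin n → ℝ)} {a b : (Fin n → ℝ) → ℝ}
    (ha : IsSemialgebraicFunOn ℚ τ a) (hb : IsSemialgebraicFunOn ℚ τ b) :
    IsSemialgebraic ℚ (openBand τ a b) := by
  rw [← band_diff_graphs_eq_openBand]
  exact (KZlog.isSemialgebraic_band ha hb).diff
    ((isSemialgebraicFunOn_iff.mp ha).union (isSemialgebraicFunOn_iff.mp hb))

open Classical in
/-- Extension by zero, off the open band, of a fibrewise derivative given on open fibres only. -/
def dExt (τ : Set (Fin n → ℝ)) (a b : (Fin n → ℝ) → ℝ) (F' : (Fin (n + 1) → ℝ) → ℝ) :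
    (Fin (n + 1) → ℝ) → ℝ :=
  fun z => if z ∈ openBand τ a b then F' z else 0

/-- On the open band the extension is the given derivative. [folklore] -/
theorem dExt_of_mem {τ : Set (Fin n → ℝ)} {a b : (Fin n → ℝ) → ℝ} {F' : (Fin (n + 1) → ℝ) → ℝ}
    {z : Fin (n + 1) → ℝ} (hz : z ∈ openBand τ a b) : dExt τ a b F' z = F' z := by
  unfold dExt; exact if_pos hz

/-- Off the open band the extension vanishes. [folklore] -/
theorem dExt_of_not_mem {τ : Set (Fin n → ℝ)} {a b : (Fin n → ℝ) → ℝ} {F' : (Fin (n + 1) → ℝ) → ℝ}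
    {z : Fin (n + 1) → ℝ} (hz : z ∉ openBand τ a b) : dExt τ a b F' z = 0 := by
  unfold dExt; exact if_neg hz

/-- The extension at an interior fibre point. [folklore] -/
theorem dExt_snoc {τ : Set (Fin n → ℝ)} {a b : (Fin n → ℝ) → ℝ} {F' : (Fin (n + 1) → ℝ) → ℝ}
    {x : Fin n → ℝ} {t : ℝ} (hx : x ∈ τ) (ht : t ∈ Ioo (a x) (b x)) :
    dExt τ a b F' (Fin.snoc x t) = F' (Fin.snoc x t) :=
  dExt_of_mem (snoc_mem_openBand.2 ⟨hx, ht⟩)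

/-- **Glue (a).** The fibre derivative of a semialgebraic function, extended by zero off the open
band, is semialgebraic on the CLOSED band (BPR Prop. 3.22 in tree + gluing with `0` on the edges). -/
theorem sa_dExt {τ : Set (Fin n → ℝ)} {a b : (Fin n → ℝ) → ℝ} {F F' : (Fin (n + 1) → ℝ) → ℝ}
    (ha : IsSemialgebraicFunOn ℚ τ a) (hb : IsSemialgebraicFunOn ℚ τ b)
    (hF : IsSemialgebraicFunOn ℚ (KZlog.band τ a b) F)
    (hder : ∀ x ∈ τ, ∀ t ∈ Ioo (a x) (b x),
      HasDerivAt (fun s : ℝ => F (Fin.snoc x s)) (F' (Fin.snoc x t)) t) :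
    IsSemialgebraicFunOn ℚ (KZlog.band τ a b) (dExt τ a b F') := by
  have hF' : IsSemialgebraicFunOn ℚ (openBand τ a b) F' :=
    IsSemialgebraicFunOn.hasDerivAt_last_isSemialgebraic_holds n τ a b F F' ha hb hF hder
  have h0 : IsSemialgebraicFunOn ℚ (KZlog.band τ a b \ openBand τ a b) (fun _ => (0 : ℝ)) :=
    sa_zero ((KZlog.isSemialgebraic_band ha hb).diff (isSemialgebraic_openBand ha hb))
  have h := hF'.union h0 (fun z hz => dExt_of_mem hz) (fun z hz => dExt_of_not_mem hz.2)
  rwa [Set.union_sdiff_cancel openBand_subset_band] at h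

/-- **Glue (b).** Two representations with the same domain whose integrands agree on a semialgebraic
subset of full measure differ by a relation (domain additivity + null junk + congruence). -/
theorem of_sub_of_mem_relations_of_eqOn_of_null {m : ℕ} {r r' : KZ.IntegralRep m}
    (hd : r'.domain = r.domain) {G : Set (Fin m → ℝ)} (hG : IsSemialgebraic ℚ G)
    (hGs : G ⊆ r.domain) (hN : volume (r.domain \ G) = 0) (heq : EqOn r.integrand r'.integrand G) :
    KZ.of r - KZ.of r' ∈ KZ.relations := by
  have hGs' : G ⊆ r'.domain := by rw [hd]; exact hGs
  have hN' : volume (r'.domain \ G) = 0 := by rw [hd]; exact hN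
  have split : ∀ (R : KZ.IntegralRep m) (hGR : G ⊆ R.domain) (_ : volume (R.domain \ G) = 0),
      KZ.of R - KZ.of (R.restrict G hG hGR) ∈ KZ.relations := by
    intro R hGR hNR
    have hDsa : IsSemialgebraic ℚ (R.domain \ G) := R.isSemialgebraic_domain.diff hG
    have hadd : KZ.of R - KZ.of (R.restrict G hG hGR) -
        KZ.of (R.restrict (R.domain \ G) hDsa Set.sdiff_subset) ∈ KZ.relations :=
      KZ.domainAddRel_subset_relations ⟨m, R, R.restrict G hG hGR,
        R.restrict (R.domain \ G) hDsa Set.sdiff_subset, (Set.union_sdiff_cancel hGR).symm,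
        by
          show volume (G ∩ (R.domain \ G)) = 0
          rw [Set.inter_sdiff_self, measure_empty],
        fun _ _ => rfl, fun _ _ => rfl, rfl⟩
    have hnull : KZ.of (R.restrict (R.domain \ G) hDsa Set.sdiff_subset) ∈ KZ.relations :=
      KZ.of_mem_relations_of_volume_eq_zero _ hNR
    have e : KZ.of R - KZ.of (R.restrict G hG hGR) =
        (KZ.of R - KZ.of (R.restrict G hG hGR) - KZ.of (R.restrict (R.domain \ G) hDsa Set.sdiff_subset)) +
          KZ.of (R.restrict (R.domain \ G) hDsa Set.sdiff_subset) := by abel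
    rw [e]
    exact KZ.relations.add_mem hadd hnull
  have hmid : KZ.of (r.restrict G hG hGs) - KZ.of (r'.restrict G hG hGs') ∈ KZ.relations :=
    KZ.of_sub_of_mem_relations_of_eqOn rfl heq
  have e : KZ.of r - KZ.of r' = (KZ.of r - KZ.of (r.restrict G hG hGs)) +
      (KZ.of (r.restrict G hG hGs) - KZ.of (r'.restrict G hG hGs')) -
        (KZ.of r' - KZ.of (r'.restrict G hG hGs')) := by abel
  rw [e]
  exact KZ.relations.sub_mem (KZ.relations.add_mem (split r hGs hN) hmid) (split r' hGs' hN')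

/-- **Glue (c), Tonelli bookkeeping.** Integrability of a fibre integral `K` on the base from that
of the unfolded integrand `W` on the band `B = {(x,t) | x ∈ S, a x ≤ t ≤ b x}`, given the fibrewise
bound `‖K x‖ₑ ≤ ∫⁻_{[a x, b x]} ‖W (x,t)‖ₑ` (converse direction to
`KZlog.integrableOn_band_of_lintegral_fibre_le`; `MeasurableEquiv.piFinSuccAbove`, `lintegral_prod`). -/
theorem integrableOn_of_lintegral_fibre_ge {m : ℕ} {S : Set (Fin m → ℝ)} (hS : MeasurableSet S)
    {a b : (Fin m → ℝ) → ℝ} {B : Set (Fin (m + 1) → ℝ)} (hB : MeasurableSet B)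
    (hmem : ∀ (x : Fin m → ℝ) (t : ℝ),
      (Fin.snoc x t : Fin (m + 1) → ℝ) ∈ B ↔ x ∈ S ∧ t ∈ Icc (a x) (b x))
    {W : (Fin (m + 1) → ℝ) → ℝ} (hW : IntegrableOn W B)
    {K : (Fin m → ℝ) → ℝ} (hK : AEStronglyMeasurable K (volume.restrict S))
    (hfib : ∀ x ∈ S, ‖K x‖ₑ ≤ ∫⁻ t in Icc (a x) (b x), ‖W (Fin.snoc x t)‖ₑ) :
    IntegrableOn K S := by
  refine ⟨hK, ?_⟩
  have hBW : Integrable (B.indicator W) := (integrable_indicator_iff hB).2 hW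
  set e : (Fin (m + 1) → ℝ) ≃ᵐ ℝ × (Fin m → ℝ) :=
    MeasurableEquiv.piFinSuccAbove (fun _ => ℝ) (Fin.last m) with he_def
  have he : MeasurePreserving e volume volume :=
    volume_preserving_piFinSuccAbove (fun _ => ℝ) (Fin.last m)
  have he_symm : ∀ p : ℝ × (Fin m → ℝ), e.symm p = Fin.snoc p.2 p.1 := fun p => by
    simp [he_def, MeasurableEquiv.piFinSuccAbove, Fin.snocEquiv]
  have hfib_in : ∀ x ∈ S, ∀ t, ‖B.indicator W (Fin.snoc x t)‖ₑ =
      (Icc (a x) (b x)).indicator (fun t => ‖W (Fin.snoc x t)‖ₑ) t := by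
    intro x hx t
    by_cases ht : t ∈ Icc (a x) (b x)
    · rw [indicator_of_mem ht, indicator_of_mem ((hmem x t).2 ⟨hx, ht⟩)]
    · rw [indicator_of_notMem ht, indicator_of_notMem (fun h => ht ((hmem x t).1 h).2),
        enorm_zero]
  have hmeas : AEMeasurable (fun p : ℝ × (Fin m → ℝ) => ‖B.indicator W (e.symm p)‖ₑ)
      ((volume : Measure ℝ).prod (volume : Measure (Fin m → ℝ))) := by
    rw [← Measure.volume_eq_prod]
    exact (hBW.aestronglyMeasurable.comp_quasiMeasurePreserving
      (he.symm e).quasiMeasurePreserving).enorm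
  unfold HasFiniteIntegral
  calc ∫⁻ x in S, ‖K x‖ₑ
      ≤ ∫⁻ x in S, ∫⁻ t in Icc (a x) (b x), ‖W (Fin.snoc x t)‖ₑ :=
        lintegral_mono_ae ((ae_restrict_mem hS).mono fun x hx => hfib x hx)
    _ = ∫⁻ x, S.indicator (fun x => ∫⁻ t in Icc (a x) (b x), ‖W (Fin.snoc x t)‖ₑ) x :=
        (lintegral_indicator hS _).symm
    _ = ∫⁻ x, ∫⁻ t, ‖B.indicator W (e.symm (t, x))‖ₑ := by
        refine lintegral_congr fun x => ?_
        simp_rw [he_symm]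
        by_cases hx : x ∈ S
        · rw [indicator_of_mem hx, ← lintegral_indicator measurableSet_Icc]
          simp_rw [hfib_in x hx]
        · rw [indicator_of_notMem hx]
          have h0 : ∀ t, ‖B.indicator W (Fin.snoc x t)‖ₑ = 0 := fun t => by
            rw [indicator_of_notMem (fun h => hx ((hmem x t).1 h).1), enorm_zero]
          simp_rw [h0, lintegral_zero]
    _ = ∫⁻ p, ‖B.indicator W (e.symm p)‖ₑ ∂((volume : Measure ℝ).prod
          (volume : Measure (Fin m → ℝ))) := (lintegral_prod_symm _ hmeas).symm
    _ = ∫⁻ p, ‖B.indicator W (e.symm p)‖ₑ := by rw [Measure.volume_eq_prod]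
    _ = ∫⁻ z, ‖B.indicator W z‖ₑ :=
        (he.symm e).lintegral_comp_emb e.symm.measurableEmbedding (fun z => ‖B.indicator W z‖ₑ)
    _ < ⊤ := hBW.2

/-- **THE CRUX HOLDS** (`LiouvilleUnfolding.UnfoldedLogStokes`, stmt-KontsevichZagierPeriods-2835):
glue (a)–(e) onto `KZ.unfoldedLogStokes_mem_relations`.  Consequently the crux cannot be refuted; this
theorem is the refuter's certificate that the standing-adversary search is over for the statement AS
TYPED (variants and strengthenings: §2–§3). -/
theorem unfoldedLogStokes_holds : UnfoldedLogStokes := by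
  intro n τ a b H H' V V' r₁ r₂ r₃ r₄ hτ ha hb hab hr₄d hH hV hV1 hcont hder hr₄i hr₁d hr₁i hr₂d hr₂i
    hr₃d hr₃i
  have hBdef : r₄.domain = KZlog.band τ a b := hr₄d
  rw [hBdef] at hH hV hV1 hr₄i hr₁d
  have hBsa : IsSemialgebraic ℚ (KZlog.band τ a b) := KZlog.isSemialgebraic_band ha hb
  have hBm : MeasurableSet (KZlog.band τ a b) := IsSemialgebraic.measurableSet_holds hBsa
  have hOsa : IsSemialgebraic ℚ (openBand τ a b) := isSemialgebraic_openBand ha hb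
  have hN : volume (KZlog.band τ a b \ openBand τ a b) = 0 := volume_band_diff_openBand ha hb
  have hτm : MeasurableSet τ := IsSemialgebraic.measurableSet_holds hτ
  -- (a) the fibre derivatives, extended by zero off the open band
  have hHd : IsSemialgebraicFunOn ℚ (KZlog.band τ a b) (dExt τ a b H') :=
    sa_dExt ha hb hH fun x hx t ht => (hder x hx t ht).1
  have hVd : IsSemialgebraicFunOn ℚ (KZlog.band τ a b) (dExt τ a b V') :=
    sa_dExt ha hb hV fun x hx t ht => (hder x hx t ht).2
  have hder' : ∀ x ∈ τ, ∀ t ∈ Ioo (a x) (b x),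
      HasDerivAt (fun s : ℝ => H (Fin.snoc x s)) (dExt τ a b H' (Fin.snoc x t)) t ∧
        HasDerivAt (fun s : ℝ => V (Fin.snoc x s)) (dExt τ a b V' (Fin.snoc x t)) t :=
    fun x hx t ht => by
      rw [dExt_snoc hx ht, dExt_snoc hx ht]
      exact hder x hx t ht
  -- (d) boundary compositions
  have hmap : ∀ {c : (Fin n → ℝ) → ℝ}, IsSemialgebraicFunOn ℚ τ c →
      (∀ x ∈ τ, c x ∈ Icc (a x) (b x)) →
      IsSemialgebraicMapOn ℚ τ (fun x => (Fin.snoc x (c x) : Fin (n + 1) → ℝ)) ∧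
        MapsTo (fun x => (Fin.snoc x (c x) : Fin (n + 1) → ℝ)) τ (KZlog.band τ a b) := by
    intro c hc hcm
    refine ⟨IsSemialgebraicMapOn.of_forall hτ fun j => ?_,
      fun x hx => KZlog.snoc_mem_band.2 ⟨hx, hcm x hx⟩⟩
    induction j using Fin.lastCases with
    | last => simpa only [Fin.snoc_last] using hc
    | cast i => simpa only [Fin.snoc_castSucc] using isSemialgebraicFunOn_apply hτ i
  have hbm : ∀ x ∈ τ, b x ∈ Icc (a x) (b x) := fun x hx => ⟨hab x hx, le_rfl⟩
  have ham : ∀ x ∈ τ, a x ∈ Icc (a x) (b x) := fun x hx => ⟨le_rfl, hab x hx⟩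
  have hHb : IsSemialgebraicFunOn ℚ τ fun x => H (Fin.snoc x (b x)) :=
    IsSemialgebraicFunOn.comp_isSemialgebraicMapOn_holds hH (hmap hb hbm).1 (hmap hb hbm).2
  have hVb : IsSemialgebraicFunOn ℚ τ fun x => V (Fin.snoc x (b x)) :=
    IsSemialgebraicFunOn.comp_isSemialgebraicMapOn_holds hV (hmap hb hbm).1 (hmap hb hbm).2
  have hHa : IsSemialgebraicFunOn ℚ τ fun x => H (Fin.snoc x (a x)) :=
    IsSemialgebraicFunOn.comp_isSemialgebraicMapOn_holds hH (hmap ha ham).1 (hmap ha ham).2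
  have hVa : IsSemialgebraicFunOn ℚ τ fun x => V (Fin.snoc x (a x)) :=
    IsSemialgebraicFunOn.comp_isSemialgebraicMapOn_holds hV (hmap ha ham).1 (hmap ha ham).2
  have hVb1 : ∀ x ∈ τ, 1 ≤ V (Fin.snoc x (b x)) := fun x hx =>
    hV1 _ (KZlog.snoc_mem_band.2 ⟨hx, hbm x hx⟩)
  have hVa1 : ∀ x ∈ τ, 1 ≤ V (Fin.snoc x (a x)) := fun x hx =>
    hV1 _ (KZlog.snoc_mem_band.2 ⟨hx, ham x hx⟩)
  -- (b) the honest twin RB of r₄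
  have hV0 : ∀ z ∈ KZlog.band τ a b, V z ≠ 0 := fun z hz => (lt_of_lt_of_le one_pos (hV1 z hz)).ne'
  have hRBsa : IsSemialgebraicFunOn ℚ (KZlog.band τ a b) (fun z => H z * dExt τ a b V' z / V z) :=
    (IsSemialgebraicFunOn.mul_holds hH hVd).div hV hV0
  have hae₄ : ∀ᵐ z ∂(volume.restrict (KZlog.band τ a b)),
      r₄.integrand z = H z * dExt τ a b V' z / V z := by
    have h1 : ∀ᵐ z ∂(volume.restrict (KZlog.band τ a b)), z ∉ KZlog.band τ a b \ openBand τ a b :=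
      ae_restrict_of_ae (measure_eq_zero_iff_ae_notMem.1 hN)
    filter_upwards [h1, ae_restrict_mem hBm] with z hz1 hz2
    have hz : z ∈ openBand τ a b := by_contra fun h => hz1 ⟨hz2, h⟩
    rw [dExt_of_mem hz, hr₄i z hz2 hz.2.1 hz.2.2]
  have hint₄ : IntegrableOn r₄.integrand (KZlog.band τ a b) := hBdef ▸ r₄.integrableOn
  let RB : KZ.IntegralRep (n + 1) := ⟨KZlog.band τ a b, fun z => H z * dExt τ a b V' z / V z, hBsa,
    hRBsa, hint₄.congr_fun_ae hae₄⟩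
  -- (b) the honest twin W of r₁
  have hr₁d' : r₁.domain = KZlog.band (KZlog.band τ a b) (fun _ => 1) V := hr₁d
  have hmem₁ : ∀ (z : Fin (n + 1) → ℝ) (u : ℝ), (Fin.snoc z u : Fin (n + 2) → ℝ) ∈ r₁.domain ↔
      z ∈ KZlog.band τ a b ∧ u ∈ Icc 1 (V z) := fun z u => by
    rw [hr₁d']; exact KZlog.snoc_mem_band
  have h1sa : IsSemialgebraic ℚ r₁.domain := r₁.isSemialgebraic_domain
  have h1m : MeasurableSet r₁.domain := IsSemialgebraic.measurableSet_holds h1sa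
  have hWsa : IsSemialgebraicFunOn ℚ r₁.domain
      (fun w => dExt τ a b H' (Fin.init w) / w (Fin.last (n + 1))) := by
    refine (hHd.comp_init_mono h1sa ?_).div (isSemialgebraicFunOn_apply h1sa _) ?_
    · intro w hw; rw [hr₁d'] at hw; exact hw.1
    · intro w hw; rw [hr₁d'] at hw; exact (lt_of_lt_of_le one_pos hw.2.1).ne'
  have hN₁ : volume {w : Fin (n + 2) → ℝ | Fin.init w ∈ KZlog.band τ a b \ openBand τ a b} = 0 :=
    KZ.volume_setOf_init_mem_eq_zero hN
  have hae₁ : ∀ᵐ w ∂(volume.restrict r₁.domain),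
      r₁.integrand w = dExt τ a b H' (Fin.init w) / w (Fin.last (n + 1)) := by
    have h1 : ∀ᵐ w ∂(volume.restrict r₁.domain),
        w ∉ {w : Fin (n + 2) → ℝ | Fin.init w ∈ KZlog.band τ a b \ openBand τ a b} :=
      ae_restrict_of_ae (measure_eq_zero_iff_ae_notMem.1 hN₁)
    filter_upwards [h1, ae_restrict_mem h1m] with w hw1 hw2
    have hwB : Fin.init w ∈ KZlog.band τ a b := by rw [hr₁d'] at hw2; exact hw2.1
    have hw : Fin.init w ∈ openBand τ a b := by_contra fun h => hw1 ⟨hwB, h⟩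
    rw [dExt_of_mem hw, hr₁i w hw2 hw.2.1 hw.2.2]
  let W : KZ.IntegralRep (n + 2) := ⟨r₁.domain, fun w => dExt τ a b H' (Fin.init w) / w (Fin.last (n + 1)),
    h1sa, hWsa, r₁.integrableOn.congr_fun_ae hae₁⟩
  -- (c) integrability of the monomials, read off r₁, r₂, r₃ by Tonelli
  have hlog : ∀ {S : Set (Fin n → ℝ)} {f : (Fin n → ℝ) → ℝ}, IsSemialgebraicFunOn ℚ S f →
      MeasurableSet S → AEStronglyMeasurable (fun x => Real.log (f x)) (volume.restrict S) :=
    fun hf hS => (Real.measurable_log.comp_aemeasurable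
      (KZ.aestronglyMeasurable_of_isSemialgebraicFunOn hf hS).aemeasurable).aestronglyMeasurable
  have hlogV : AEStronglyMeasurable (fun z => Real.log (V z)) (volume.restrict (KZlog.band τ a b)) :=
    (Real.measurable_log.comp_aemeasurable
      (KZ.aestronglyMeasurable_of_isSemialgebraicFunOn hV hBm).aemeasurable).aestronglyMeasurable
  have hintH' : IntegrableOn (fun z => dExt τ a b H' z * Real.log (V z)) (KZlog.band τ a b) := by
    refine integrableOn_of_lintegral_fibre_ge hBm h1m hmem₁ W.integrableOn
      ((KZ.aestronglyMeasurable_of_isSemialgebraicFunOn hHd hBm).mul hlogV) fun z hz => ?_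
    by_cases hzo : z ∈ openBand τ a b
    · rw [dExt_of_mem hzo, ← KZlog.lintegral_enorm_div_Icc_one _ _ (hV1 z hz)]
      refine (setLIntegral_congr_fun measurableSet_Icc fun u _ => ?_).le
      show ‖H' z / u‖ₑ = ‖dExt τ a b H' (Fin.init (Fin.snoc z u : Fin (n + 2) → ℝ)) /
        (Fin.snoc z u : Fin (n + 2) → ℝ) (Fin.last (n + 1))‖ₑ
      rw [Fin.init_snoc, Fin.snoc_last, dExt_of_mem hzo]
    · rw [dExt_of_not_mem hzo, zero_mul, enorm_zero]
      exact zero_le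
  have hmem₂ : ∀ (x : Fin n → ℝ) (u : ℝ), (Fin.snoc x u : Fin (n + 1) → ℝ) ∈ r₂.domain ↔
      x ∈ τ ∧ u ∈ Icc 1 (V (Fin.snoc x (b x))) := fun x u => by
    rw [hr₂d]; simp [mem_Icc]
  have hmem₃ : ∀ (x : Fin n → ℝ) (u : ℝ), (Fin.snoc x u : Fin (n + 1) → ℝ) ∈ r₃.domain ↔
      x ∈ τ ∧ u ∈ Icc 1 (V (Fin.snoc x (a x))) := fun x u => by
    rw [hr₃d]; simp [mem_Icc]
  have h2m : MeasurableSet r₂.domain := IsSemialgebraic.measurableSet_holds r₂.isSemialgebraic_domain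
  have h3m : MeasurableSet r₃.domain := IsSemialgebraic.measurableSet_holds r₃.isSemialgebraic_domain
  have hintb : IntegrableOn (fun x => H (Fin.snoc x (b x)) * Real.log (V (Fin.snoc x (b x)))) τ := by
    refine integrableOn_of_lintegral_fibre_ge hτm h2m hmem₂ r₂.integrableOn
      ((KZ.aestronglyMeasurable_of_isSemialgebraicFunOn hHb hτm).mul (hlog hVb hτm)) fun x hx => ?_
    rw [← KZlog.lintegral_enorm_div_Icc_one _ _ (hVb1 x hx)]
    refine (setLIntegral_congr_fun measurableSet_Icc fun u hu => ?_).le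
    show ‖H (Fin.snoc x (b x)) / u‖ₑ = ‖r₂.integrand (Fin.snoc x u)‖ₑ
    rw [hr₂i _ ((hmem₂ x u).2 ⟨hx, hu⟩), Fin.init_snoc, Fin.snoc_last]
  have hinta : IntegrableOn (fun x => H (Fin.snoc x (a x)) * Real.log (V (Fin.snoc x (a x)))) τ := by
    refine integrableOn_of_lintegral_fibre_ge hτm h3m hmem₃ r₃.integrableOn
      ((KZ.aestronglyMeasurable_of_isSemialgebraicFunOn hHa hτm).mul (hlog hVa hτm)) fun x hx => ?_
    rw [← KZlog.lintegral_enorm_div_Icc_one _ _ (hVa1 x hx)]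
    refine (setLIntegral_congr_fun measurableSet_Icc fun u hu => ?_).le
    show ‖H (Fin.snoc x (a x)) / u‖ₑ = ‖r₃.integrand (Fin.snoc x u)‖ₑ
    rw [hr₃i _ ((hmem₃ x u).2 ⟨hx, hu⟩), Fin.init_snoc, Fin.snoc_last]
  -- the tree theorem, with Ub := r₂ and Ua := r₃.neg
  have htree : KZ.of RB + KZ.of W - KZ.of r₂ - KZ.of r₃.neg ∈ KZ.relations :=
    KZ.unfoldedLogStokes_mem_relations hτ ha hb hab hH hHd hV hVd hV1 hcont hder' RB.integrableOn
      hintH' hHb hVb hHa hVa hintb hinta RB W r₂ r₃.neg rfl (fun _ _ => rfl) hr₁d' (fun _ _ => rfl)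
      hr₂d (fun z hz => hr₂i z hz) hr₃d (fun z hz => by
        show -(r₃.integrand z) = -H (Fin.snoc (Fin.init z) (a (Fin.init z))) / z (Fin.last n)
        rw [hr₃i z hz, neg_div])
  -- (b) r₄ ∼ RB and r₁ ∼ W (they agree off null semialgebraic sets), (e) r₃ + r₃.neg ∼ 0
  have h4 : KZ.of r₄ - KZ.of RB ∈ KZ.relations := by
    refine of_sub_of_mem_relations_of_eqOn_of_null (r := r₄) (r' := RB) hBdef.symm hOsa
      (by rw [hBdef]; exact openBand_subset_band) (by rw [hBdef]; exact hN) fun z hz => ?_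
    show r₄.integrand z = H z * dExt τ a b V' z / V z
    rw [dExt_of_mem hz, hr₄i z (openBand_subset_band hz) hz.2.1 hz.2.2]
  have h1 : KZ.of r₁ - KZ.of W ∈ KZ.relations := by
    refine of_sub_of_mem_relations_of_eqOn_of_null (r := r₁) (r' := W) rfl
      (G := r₁.domain ∩ {w | Fin.init w ∈ openBand τ a b}) (h1sa.inter hOsa.setOf_init_mem)
      inter_subset_left (measure_mono_null (fun w hw => ?_) hN₁) fun w hw => ?_
    · have hwB : Fin.init w ∈ KZlog.band τ a b := by
        have hw1 := hw.1
        rw [hr₁d'] at hw1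
        exact hw1.1
      exact ⟨hwB, fun h => hw.2 ⟨hw.1, h⟩⟩
    · show r₁.integrand w = dExt τ a b H' (Fin.init w) / w (Fin.last (n + 1))
      rw [dExt_of_mem hw.2, hr₁i w hw.1 hw.2.2.1 hw.2.2.2]
  have h3 : KZ.of r₃ + KZ.of r₃.neg ∈ KZ.relations :=
    KZ.of_add_of_mem_relations_of_eqOn_neg rfl (fun _ _ => rfl)
  have key : KZ.of r₁ - KZ.of r₂ + KZ.of r₃ + KZ.of r₄ =
      (KZ.of RB + KZ.of W - KZ.of r₂ - KZ.of r₃.neg) + (KZ.of r₄ - KZ.of RB) + (KZ.of r₁ - KZ.of W) +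
        (KZ.of r₃ + KZ.of r₃.neg) := by abel
  rw [key]
  exact KZ.relations.add_mem (KZ.relations.add_mem (KZ.relations.add_mem htree h4) h1) h3

end Positive

/-! ## §5 Redundant hypotheses — the semialgebraicity of the base data and of `V` is decoration
(cycle 3, gen 2)

Hypothesis mutation, continued.  The crux carries FIVE semialgebraicity hypotheses (`τ`, `a`, `b` on
the base; `H`, `V` on the band).  FOUR of them are DERIVABLE from the honesty of `r₄`, `r₁` (their
domains are `ℚ`-semialgebraic — a field of `KZ.IntegralRep`) together with `hab`, `hr₄d`, `hr₁d`,
`hV1`: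
* `b` (resp. `a`) is the upper (resp. lower) EDGE FUNCTION of the semialgebraic band `r₄.domain`, whose
  fibres are non-empty by `hab` — semialgebraic by one Tarski–Seidenberg projection and a complement
  (`isSemialgebraicFunOn_upper_of_band`, `isSemialgebraicFunOn_lower_of_band`);
* `τ` is the projection of the graph of `b` (`isSemialgebraic_of_funOn`);
* `V` is the upper edge function of the semialgebraic band `r₁.domain = {1 ≤ u ≤ V}` over `r₄.domain`
  (fibres non-empty exactly because `1 ≤ V`).
Hence `WithoutSaData` (all four deleted) is EQUIVALENT to the crux (`withoutSaData_iff`) and holds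
(`withoutSaData_holds`).  Planner: the statement can be slimmed by four clauses with no change of
content.  Refuters: no mutation of these four can ever bite.  The fifth, `hH`, is NOT derivable — `H` is
invisible to the representations wherever `V' = 0` (e.g. `n = 0`, `V ≡ 2`, `H = log ((1+t)(2−t)/2)` on
`[0,1]`: `H' = 1/(1+t) − 1/(2−t)` and `H(0) = H(1) = 0` make all four representations honest while `H`
is not semialgebraic) — and §6 shows that it is also invisible to `eval`.
-/

section Redundant

variable {m : ℕ}

/-- The base of a `ℚ`-semialgebraic function is `ℚ`-semialgebraic (projection of the graph,
Tarski–Seidenberg `tarski_seidenberg_real_holds`). [folklore] -/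
theorem isSemialgebraic_of_funOn {s : Set (Fin m → ℝ)} {f : (Fin m → ℝ) → ℝ}
    (hf : IsSemialgebraicFunOn ℚ s f) : IsSemialgebraic ℚ s := by
  have h := tarski_seidenberg_real_holds (k := ℚ) (isSemialgebraicFunOn_iff.mp hf)
  convert h using 1
  ext x
  simp only [mem_image, mem_setOf_eq]
  constructor
  · intro hx
    refine ⟨Fin.snoc x (f x), ⟨by simpa using hx, by simp⟩, ?_⟩
    funext i
    simp
  · rintro ⟨z, ⟨hz, -⟩, rfl⟩
    exact hz

/-- Coordinate embedding reading `(x, s)` off `w = (x, t, s) ∈ ℝᵐ⁺²`: `w ∘ σup m = (init (init w), w last)`.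
[folklore] -/
def σup (m : ℕ) : Fin (m + 1) → Fin (m + 2) :=
  Fin.snoc (fun i : Fin m => Fin.castSucc (Fin.castSucc i)) (Fin.last (m + 1))

theorem comp_σup (w : Fin (m + 2) → ℝ) :
    (w ∘ σup m) = Fin.snoc (Fin.init (Fin.init w)) (w (Fin.last (m + 1))) := by
  funext j
  induction j using Fin.lastCases with
  | last => simp [σup]
  | cast i => simp [σup, Fin.init]

/-- The points of `ℝᵐ⁺¹` lying strictly BELOW some point of `B` on the same vertical line form a
`ℚ`-semialgebraic set: the Tarski–Seidenberg projection (along the new last coordinate `s`) of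
`{(z, s) | (init z, s) ∈ B ∧ z last < s}`. [BCR 1998, Thm. 2.2.1] [folklore] -/
theorem isSemialgebraic_setOf_exists_above {B : Set (Fin (m + 1) → ℝ)} (hB : IsSemialgebraic ℚ B) :
    IsSemialgebraic ℚ {z : Fin (m + 1) → ℝ | ∃ s : ℝ,
      (Fin.snoc (Fin.init z) s : Fin (m + 1) → ℝ) ∈ B ∧ z (Fin.last m) < s} := by
  have hT := (hB.preimage_comp (σup m)).inter
    (sa_lt (k := ℚ) (Fin.castSucc (Fin.last m)) (Fin.last (m + 1)))
  convert tarski_seidenberg_real_holds (k := ℚ) hT using 1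
  ext z
  simp only [mem_setOf_eq, mem_image, mem_inter_iff, mem_preimage]
  constructor
  · rintro ⟨s, hs, hlt⟩
    refine ⟨Fin.snoc z s, ⟨?_, ?_⟩, ?_⟩
    · rw [comp_σup]
      simpa using hs
    · simpa using hlt
    · funext i
      simp
  · rintro ⟨w, ⟨hwB, hwlt⟩, rfl⟩
    refine ⟨w (Fin.last (m + 1)), ?_, ?_⟩
    · rw [comp_σup] at hwB
      exact hwB
    · exact hwlt

/-- Same, strictly ABOVE: `{z | ∃ s, (init z, s) ∈ B ∧ s < z last}` is `ℚ`-semialgebraic. [folklore] -/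
theorem isSemialgebraic_setOf_exists_below {B : Set (Fin (m + 1) → ℝ)} (hB : IsSemialgebraic ℚ B) :
    IsSemialgebraic ℚ {z : Fin (m + 1) → ℝ | ∃ s : ℝ,
      (Fin.snoc (Fin.init z) s : Fin (m + 1) → ℝ) ∈ B ∧ s < z (Fin.last m)} := by
  have hT := (hB.preimage_comp (σup m)).inter
    (sa_lt (k := ℚ) (Fin.last (m + 1)) (Fin.castSucc (Fin.last m)))
  convert tarski_seidenberg_real_holds (k := ℚ) hT using 1
  ext z
  simp only [mem_setOf_eq, mem_image, mem_inter_iff, mem_preimage]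
  constructor
  · rintro ⟨s, hs, hlt⟩
    refine ⟨Fin.snoc z s, ⟨?_, ?_⟩, ?_⟩
    · rw [comp_σup]
      simpa using hs
    · simpa using hlt
    · funext i
      simp
  · rintro ⟨w, ⟨hwB, hwlt⟩, rfl⟩
    refine ⟨w (Fin.last (m + 1)), ?_, ?_⟩
    · rw [comp_σup] at hwB
      exact hwB
    · exact hwlt

/-- **The upper edge of a semialgebraic band with non-empty fibres is a semialgebraic function**: if
`{(x,t) | x ∈ S, lo x ≤ t ≤ hi x}` is `ℚ`-semialgebraic and `lo ≤ hi` on `S`, then `hi` is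
`ℚ`-semialgebraic on `S` — its graph is the band minus the points strictly below another band point.
[BCR 1998, §2.2] [folklore] -/
theorem isSemialgebraicFunOn_upper_of_band {S : Set (Fin m → ℝ)} {lo hi : (Fin m → ℝ) → ℝ}
    (hB : IsSemialgebraic ℚ (KZlog.band S lo hi)) (hle : ∀ x ∈ S, lo x ≤ hi x) :
    IsSemialgebraicFunOn ℚ S hi := by
  rw [isSemialgebraicFunOn_iff]
  convert hB.diff (isSemialgebraic_setOf_exists_above hB) using 1
  ext z
  constructor
  · rintro ⟨hz, heq⟩
    refine ⟨⟨hz, by rw [heq]; exact hle _ hz, heq.le⟩, ?_⟩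
    rintro ⟨s, hs, hlt⟩
    rw [KZlog.snoc_mem_band] at hs
    rw [heq] at hlt
    exact (not_lt.2 hs.2.2) hlt
  · rintro ⟨⟨hz, -, hhi⟩, hno⟩
    refine ⟨hz, le_antisymm hhi (not_lt.1 fun hlt => hno ⟨hi (Fin.init z), ?_, hlt⟩)⟩
    exact KZlog.snoc_mem_band.2 ⟨hz, hle _ hz, le_rfl⟩

/-- **The lower edge of a semialgebraic band with non-empty fibres is a semialgebraic function.**
[BCR 1998, §2.2] [folklore] -/
theorem isSemialgebraicFunOn_lower_of_band {S : Set (Fin m → ℝ)} {lo hi : (Fin m → ℝ) → ℝ}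
    (hB : IsSemialgebraic ℚ (KZlog.band S lo hi)) (hle : ∀ x ∈ S, lo x ≤ hi x) :
    IsSemialgebraicFunOn ℚ S lo := by
  rw [isSemialgebraicFunOn_iff]
  convert hB.diff (isSemialgebraic_setOf_exists_below hB) using 1
  ext z
  constructor
  · rintro ⟨hz, heq⟩
    refine ⟨⟨hz, heq.ge, by rw [heq]; exact hle _ hz⟩, ?_⟩
    rintro ⟨s, hs, hlt⟩
    rw [KZlog.snoc_mem_band] at hs
    rw [heq] at hlt
    exact (not_lt.2 hs.2.1) hlt
  · rintro ⟨⟨hz, hlo, -⟩, hno⟩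
    refine ⟨hz, le_antisymm (not_lt.1 fun hlt => hno ⟨lo (Fin.init z), ?_, hlt⟩) hlo⟩
    exact KZlog.snoc_mem_band.2 ⟨hz, le_rfl, hle _ hz⟩

/-- The base of a semialgebraic band with non-empty fibres is semialgebraic. [folklore] -/
theorem isSemialgebraic_base_of_band {S : Set (Fin m → ℝ)} {lo hi : (Fin m → ℝ) → ℝ}
    (hB : IsSemialgebraic ℚ (KZlog.band S lo hi)) (hle : ∀ x ∈ S, lo x ≤ hi x) :
    IsSemialgebraic ℚ S :=
  isSemialgebraic_of_funOn (isSemialgebraicFunOn_upper_of_band hB hle)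

/-- The crux with the FOUR semialgebraicity hypotheses on `τ`, `a`, `b` (base data) and on `V` DELETED
(all other clauses verbatim, cf. `Orig`). -/
def WithoutSaData : Prop :=
  ∀ (n : ℕ) (τ : Set (Fin n → ℝ)) (a b : (Fin n → ℝ) → ℝ) (H H' V V' : (Fin (n + 1) → ℝ) → ℝ) (r₁ : Literature.NumberTheory.Transcendental.KZ.IntegralRep (n + 2)) (r₂ r₃ r₄ : Literature.NumberTheory.Transcendental.KZ.IntegralRep (n + 1)),
    (∀ x ∈ τ, a x ≤ b x) →
    r₄.domain = {z | (Fin.init z : Fin n → ℝ) ∈ τ ∧ a (Fin.init z) ≤ z (Fin.last n) ∧ z (Fin.last n) ≤ b (Fin.init z)} →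
    Literature.NumberTheory.Transcendental.IsSemialgebraicFunOn ℚ r₄.domain H →
    (∀ z ∈ r₄.domain, 1 ≤ V z) →
    (∀ x ∈ τ, ContinuousOn (fun t : ℝ => H (Fin.snoc x t)) (Set.Icc (a x) (b x)) ∧ ContinuousOn (fun t : ℝ => V (Fin.snoc x t)) (Set.Icc (a x) (b x))) →
    (∀ x ∈ τ, ∀ t ∈ Set.Ioo (a x) (b x), HasDerivAt (fun s : ℝ => H (Fin.snoc x s)) (H' (Fin.snoc x t)) t ∧ HasDerivAt (fun s : ℝ => V (Fin.snoc x s)) (V' (Fin.snoc x t)) t) →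
    (∀ z ∈ r₄.domain, a (Fin.init z) < z (Fin.last n) → z (Fin.last n) < b (Fin.init z) → r₄.integrand z = H z * V' z / V z) →
    r₁.domain = {w | (Fin.init w : Fin (n + 1) → ℝ) ∈ r₄.domain ∧ 1 ≤ w (Fin.last (n + 1)) ∧ w (Fin.last (n + 1)) ≤ V (Fin.init w)} →
    (∀ w ∈ r₁.domain, a (Fin.init (Fin.init w)) < Fin.init w (Fin.last n) → Fin.init w (Fin.last n) < b (Fin.init (Fin.init w)) → r₁.integrand w = H' (Fin.init w) / w (Fin.last (n + 1))) →
    r₂.domain = {z | (Fin.init z : Fin n → ℝ) ∈ τ ∧ 1 ≤ z (Fin.last n) ∧ z (Fin.last n) ≤ V (Fin.snoc (Fin.init z) (b (Fin.init z)))} →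
    (∀ z ∈ r₂.domain, r₂.integrand z = H (Fin.snoc (Fin.init z) (b (Fin.init z))) / z (Fin.last n)) →
    r₃.domain = {z | (Fin.init z : Fin n → ℝ) ∈ τ ∧ 1 ≤ z (Fin.last n) ∧ z (Fin.last n) ≤ V (Fin.snoc (Fin.init z) (a (Fin.init z)))} →
    (∀ z ∈ r₃.domain, r₃.integrand z = H (Fin.snoc (Fin.init z) (a (Fin.init z))) / z (Fin.last n)) →
    Literature.NumberTheory.Transcendental.KZ.of r₁ - Literature.NumberTheory.Transcendental.KZ.of r₂ + Literature.NumberTheory.Transcendental.KZ.of r₃ + Literature.NumberTheory.Transcendental.KZ.of r₄ ∈ Literature.NumberTheory.Transcendental.KZ.relations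

/-- **Four semialgebraicity hypotheses are decoration**: `τ`, `a`, `b` semialgebraic and `V`
semialgebraic on the band are DERIVABLE from the honesty of `r₄`, `r₁` (semialgebraic domains) plus
`hab`, `hr₄d`, `hr₁d`, `hV1`; so the slimmed statement is equivalent to the crux. -/
theorem withoutSaData_iff : WithoutSaData ↔ UnfoldedLogStokes := by
  constructor
  · intro h n τ a b H H' V V' r₁ r₂ r₃ r₄ _ _ _ hab hr₄d hH _ hV1
    exact h n τ a b H H' V V' r₁ r₂ r₃ r₄ hab hr₄d hH hV1
  · intro h n τ a b H H' V V' r₁ r₂ r₃ r₄ hab hr₄d hH hV1 hcont hder hr₄i hr₁d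
    have hB : IsSemialgebraic ℚ (KZlog.band τ a b) := by
      have h4 := r₄.isSemialgebraic_domain
      rwa [hr₄d] at h4
    have hb : IsSemialgebraicFunOn ℚ τ b := isSemialgebraicFunOn_upper_of_band hB hab
    have ha : IsSemialgebraicFunOn ℚ τ a := isSemialgebraicFunOn_lower_of_band hB hab
    have hτ : IsSemialgebraic ℚ τ := isSemialgebraic_of_funOn hb
    have hV : IsSemialgebraicFunOn ℚ r₄.domain V := by
      have h1 := r₁.isSemialgebraic_domain
      rw [hr₁d] at h1
      exact isSemialgebraicFunOn_upper_of_band (S := r₄.domain) (lo := fun _ => (1 : ℝ)) (hi := V)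
        h1 hV1
    exact h n τ a b H H' V V' r₁ r₂ r₃ r₄ hτ ha hb hab hr₄d hH hV hV1 hcont hder hr₄i hr₁d

/-- … and therefore the slimmed statement HOLDS (from §4). -/
theorem withoutSaData_holds : WithoutSaData := withoutSaData_iff.2 unfoldedLogStokes_holds

end Redundant

/-! ## §6 The invisible hypothesis `hH` — deleting it keeps `eval = 0`; any kill would refute the
Kontsevich–Zagier period conjecture itself (cycle 3, gen 2)

`WithoutSaH` (the crux with `IsSemialgebraicFunOn ℚ r₄.domain H` deleted) is a genuinely stronger
statement: the unfolded log-Stokes relation for `H` in the closure of the semialgebraic functions under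
fibrewise primitives (its boundary traces `H(·, b ·)`, `H(·, a ·)` and its fibre derivative `H'` ARE
forced semialgebraic by `r₂`, `r₃`, `r₁` read at `u = 1`, but `H` itself is free off `{V' ≠ 0}`).  The
VALUE identity survives verbatim — `values_cancel_without_saH`: Fubini + FTC for `F = H · log V` on the
band (`KZlog.setIntegral_band_eq_of_hasDerivAt`), the three unfolded values by the same lemma with
`F = c · log u` (`setIntegral_unfold_eq`), measurability read off the representations — so the
combination is a kernel element for EVERY admissible `H`, and
`withoutSaH_of_kzKernelConjecture : KZKernelConjecture → WithoutSaH`.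
Contrapositive (`not_kzKernelConjecture_of_not_withoutSaH`): a counterexample to `WithoutSaH` is an
element of `ker eval ∖ relations`, i.e. a DISPROOF OF THE PERIOD CONJECTURE (the summit in kernel form,
`KZKernelConjecture`).  Refuters: this mutation is summit-hard, do not spend time on it.  Planners /
provers: `hH` is exactly the clause that makes the item a statement about the CALCULUS (derivability)
rather than about periods; every other hypothesis is either load-bearing for soundness (§2) or
redundant (§5).
-/

section Invisible

variable {n : ℕ}

/-- The hypotheses of the crux with `IsSemialgebraicFunOn ℚ r₄.domain H` DELETED, as a predicate
transformer: `HypsWithoutSaH P` says that `P r₁ r₂ r₃ r₄` holds for all data satisfying them. -/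
def HypsWithoutSaH (P : ∀ {n : ℕ}, KZ.IntegralRep (n + 2) → KZ.IntegralRep (n + 1) →
    KZ.IntegralRep (n + 1) → KZ.IntegralRep (n + 1) → Prop) : Prop :=
  ∀ (n : ℕ) (τ : Set (Fin n → ℝ)) (a b : (Fin n → ℝ) → ℝ) (H H' V V' : (Fin (n + 1) → ℝ) → ℝ) (r₁ : Literature.NumberTheory.Transcendental.KZ.IntegralRep (n + 2)) (r₂ r₃ r₄ : Literature.NumberTheory.Transcendental.KZ.IntegralRep (n + 1)), Literature.ModelTheory.ExponentialFields.IsSemialgebraic ℚ τ →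
    Literature.NumberTheory.Transcendental.IsSemialgebraicFunOn ℚ τ a →
    Literature.NumberTheory.Transcendental.IsSemialgebraicFunOn ℚ τ b →
    (∀ x ∈ τ, a x ≤ b x) →
    r₄.domain = {z | (Fin.init z : Fin n → ℝ) ∈ τ ∧ a (Fin.init z) ≤ z (Fin.last n) ∧ z (Fin.last n) ≤ b (Fin.init z)} →
    Literature.NumberTheory.Transcendental.IsSemialgebraicFunOn ℚ r₄.domain V →
    (∀ z ∈ r₄.domain, 1 ≤ V z) →
    (∀ x ∈ τ, ContinuousOn (fun t : ℝ => H (Fin.snoc x t)) (Set.Icc (a x) (b x)) ∧ ContinuousOn (fun t : ℝ => V (Fin.snoc x t)) (Set.Icc (a x) (b x))) →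
    (∀ x ∈ τ, ∀ t ∈ Set.Ioo (a x) (b x), HasDerivAt (fun s : ℝ => H (Fin.snoc x s)) (H' (Fin.snoc x t)) t ∧ HasDerivAt (fun s : ℝ => V (Fin.snoc x s)) (V' (Fin.snoc x t)) t) →
    (∀ z ∈ r₄.domain, a (Fin.init z) < z (Fin.last n) → z (Fin.last n) < b (Fin.init z) → r₄.integrand z = H z * V' z / V z) →
    r₁.domain = {w | (Fin.init w : Fin (n + 1) → ℝ) ∈ r₄.domain ∧ 1 ≤ w (Fin.last (n + 1)) ∧ w (Fin.last (n + 1)) ≤ V (Fin.init w)} →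
    (∀ w ∈ r₁.domain, a (Fin.init (Fin.init w)) < Fin.init w (Fin.last n) → Fin.init w (Fin.last n) < b (Fin.init (Fin.init w)) → r₁.integrand w = H' (Fin.init w) / w (Fin.last (n + 1))) →
    r₂.domain = {z | (Fin.init z : Fin n → ℝ) ∈ τ ∧ 1 ≤ z (Fin.last n) ∧ z (Fin.last n) ≤ V (Fin.snoc (Fin.init z) (b (Fin.init z)))} →
    (∀ z ∈ r₂.domain, r₂.integrand z = H (Fin.snoc (Fin.init z) (b (Fin.init z))) / z (Fin.last n)) →
    r₃.domain = {z | (Fin.init z : Fin n → ℝ) ∈ τ ∧ 1 ≤ z (Fin.last n) ∧ z (Fin.last n) ≤ V (Fin.snoc (Fin.init z) (a (Fin.init z)))} →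
    (∀ z ∈ r₃.domain, r₃.integrand z = H (Fin.snoc (Fin.init z) (a (Fin.init z))) / z (Fin.last n)) →
    P r₁ r₂ r₃ r₄

/-- The crux with the hypothesis `IsSemialgebraicFunOn ℚ r₄.domain H` DELETED (all other clauses
verbatim, cf. `Orig`). -/
def WithoutSaH : Prop :=
  ∀ (n : ℕ) (τ : Set (Fin n → ℝ)) (a b : (Fin n → ℝ) → ℝ) (H H' V V' : (Fin (n + 1) → ℝ) → ℝ) (r₁ : Literature.NumberTheory.Transcendental.KZ.IntegralRep (n + 2)) (r₂ r₃ r₄ : Literature.NumberTheory.Transcendental.KZ.IntegralRep (n + 1)), Literature.ModelTheory.ExponentialFields.IsSemialgebraic ℚ τ →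
    Literature.NumberTheory.Transcendental.IsSemialgebraicFunOn ℚ τ a →
    Literature.NumberTheory.Transcendental.IsSemialgebraicFunOn ℚ τ b →
    (∀ x ∈ τ, a x ≤ b x) →
    r₄.domain = {z | (Fin.init z : Fin n → ℝ) ∈ τ ∧ a (Fin.init z) ≤ z (Fin.last n) ∧ z (Fin.last n) ≤ b (Fin.init z)} →
    Literature.NumberTheory.Transcendental.IsSemialgebraicFunOn ℚ r₄.domain V →
    (∀ z ∈ r₄.domain, 1 ≤ V z) →
    (∀ x ∈ τ, ContinuousOn (fun t : ℝ => H (Fin.snoc x t)) (Set.Icc (a x) (b x)) ∧ ContinuousOn (fun t : ℝ => V (Fin.snoc x t)) (Set.Icc (a x) (b x))) →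
    (∀ x ∈ τ, ∀ t ∈ Set.Ioo (a x) (b x), HasDerivAt (fun s : ℝ => H (Fin.snoc x s)) (H' (Fin.snoc x t)) t ∧ HasDerivAt (fun s : ℝ => V (Fin.snoc x s)) (V' (Fin.snoc x t)) t) →
    (∀ z ∈ r₄.domain, a (Fin.init z) < z (Fin.last n) → z (Fin.last n) < b (Fin.init z) → r₄.integrand z = H z * V' z / V z) →
    r₁.domain = {w | (Fin.init w : Fin (n + 1) → ℝ) ∈ r₄.domain ∧ 1 ≤ w (Fin.last (n + 1)) ∧ w (Fin.last (n + 1)) ≤ V (Fin.init w)} →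
    (∀ w ∈ r₁.domain, a (Fin.init (Fin.init w)) < Fin.init w (Fin.last n) → Fin.init w (Fin.last n) < b (Fin.init (Fin.init w)) → r₁.integrand w = H' (Fin.init w) / w (Fin.last (n + 1))) →
    r₂.domain = {z | (Fin.init z : Fin n → ℝ) ∈ τ ∧ 1 ≤ z (Fin.last n) ∧ z (Fin.last n) ≤ V (Fin.snoc (Fin.init z) (b (Fin.init z)))} →
    (∀ z ∈ r₂.domain, r₂.integrand z = H (Fin.snoc (Fin.init z) (b (Fin.init z))) / z (Fin.last n)) →
    r₃.domain = {z | (Fin.init z : Fin n → ℝ) ∈ τ ∧ 1 ≤ z (Fin.last n) ∧ z (Fin.last n) ≤ V (Fin.snoc (Fin.init z) (a (Fin.init z)))} →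
    (∀ z ∈ r₃.domain, r₃.integrand z = H (Fin.snoc (Fin.init z) (a (Fin.init z))) / z (Fin.last n)) →
    Literature.NumberTheory.Transcendental.KZ.of r₁ - Literature.NumberTheory.Transcendental.KZ.of r₂ + Literature.NumberTheory.Transcendental.KZ.of r₃ + Literature.NumberTheory.Transcendental.KZ.of r₄ ∈ Literature.NumberTheory.Transcendental.KZ.relations

/-- Text fidelity: `WithoutSaH` is `HypsWithoutSaH` at the crux's conclusion. -/
theorem withoutSaH_iff : WithoutSaH ↔ HypsWithoutSaH (fun {_} r₁ r₂ r₃ r₄ =>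
    KZ.of r₁ - KZ.of r₂ + KZ.of r₃ + KZ.of r₄ ∈ KZ.relations) := Iff.rfl

/-- The value of an honest unfolding `[{(y,u) | y ∈ S, 1 ≤ u ≤ v y}, g]` whose integrand is pinned to
`c y / u` on the fibres over `S` is `∫_S c · log v` (Fubini + FTC with `F = c y · log u`,
`KZlog.setIntegral_band_eq_of_hasDerivAt`). No semialgebraicity of `c` is needed. [folklore] -/
theorem setIntegral_unfold_eq {m : ℕ} {S : Set (Fin m → ℝ)} (hS : MeasurableSet S)
    {v c : (Fin m → ℝ) → ℝ} (hv : ∀ y ∈ S, 1 ≤ v y)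
    (hD : MeasurableSet (KZlog.band S (fun _ => 1) v)) {g : (Fin (m + 1) → ℝ) → ℝ}
    (hg : IntegrableOn g (KZlog.band S (fun _ => 1) v))
    (hpin : ∀ y ∈ S, ∀ u ∈ Ioo 1 (v y), g (Fin.snoc y u) = c y / u) :
    ∫ w in KZlog.band S (fun _ => 1) v, g w = ∫ y in S, c y * Real.log (v y) := by
  have h := KZlog.setIntegral_band_eq_of_hasDerivAt (n := m) hS (a := fun _ => 1) (b := v) hv hD
    (G := g) (F := fun w => c (Fin.init w) * Real.log (w (Fin.last m))) hg
    (fun y _ => by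
      simp only [Fin.init_snoc, Fin.snoc_last]
      exact continuousOn_const.mul (Real.continuousOn_log.mono fun u hu =>
        ne_of_gt (one_pos.trans_le hu.1)))
    (fun y hy u hu => by
      simp only [Fin.init_snoc, Fin.snoc_last]
      rw [hpin y hy u hu, div_eq_mul_inv]
      exact (Real.hasDerivAt_log (one_pos.trans hu.1).ne').const_mul (c y))
  rw [h]
  refine setIntegral_congr_fun hS fun y _ => ?_
  simp

/-- **`hH` is invisible to `eval`**: under the hypotheses of the crux WITHOUT the semialgebraicity of
`H`, the four values still cancel, `r₁ − r₂ + r₃ + r₄ ↦ 0` (Fubini + FTC for `F = H · log V` on the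
band; the three unfolded values by the same lemma with `F = c · log u`; the measurability of `H'`,
`H(·, b ·)`, `H(·, a ·)` is READ OFF `r₁`, `r₂`, `r₃` at `u = 1`). -/
theorem values_cancel_without_saH :
    HypsWithoutSaH (fun {_} r₁ r₂ r₃ r₄ => r₁.value - r₂.value + r₃.value + r₄.value = 0) := by
  intro n τ a b H H' V V' r₁ r₂ r₃ r₄ hτ ha hb hab hr₄d hV hV1 hcont hder hr₄i hr₁d hr₁i hr₂d hr₂i
    hr₃d hr₃i
  have hBdef : r₄.domain = KZlog.band τ a b := hr₄d
  rw [hBdef] at hV hV1 hr₄i hr₁d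
  -- measurability bookkeeping
  have hBsa : IsSemialgebraic ℚ (KZlog.band τ a b) := KZlog.isSemialgebraic_band ha hb
  have hBm : MeasurableSet (KZlog.band τ a b) := IsSemialgebraic.measurableSet_holds hBsa
  have hOsa : IsSemialgebraic ℚ (openBand τ a b) := isSemialgebraic_openBand ha hb
  have hOm : MeasurableSet (openBand τ a b) := IsSemialgebraic.measurableSet_holds hOsa
  have hN : volume (KZlog.band τ a b \ openBand τ a b) = 0 := volume_band_diff_openBand ha hb
  have hτm : MeasurableSet τ := IsSemialgebraic.measurableSet_holds hτ
  have hOB : (openBand τ a b : Set (Fin (n + 1) → ℝ)) =ᵐ[volume] (KZlog.band τ a b : Set _) :=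
    ae_eq_set.2 ⟨by rw [Set.sdiff_eq_empty.2 openBand_subset_band, measure_empty], hN⟩
  have hVO1 : ∀ z ∈ openBand τ a b, 1 ≤ V z := fun z hz => hV1 z (openBand_subset_band hz)
  have hbm : ∀ x ∈ τ, b x ∈ Icc (a x) (b x) := fun x hx => ⟨hab x hx, le_rfl⟩
  have ham : ∀ x ∈ τ, a x ∈ Icc (a x) (b x) := fun x hx => ⟨le_rfl, hab x hx⟩
  have hVb1 : ∀ x ∈ τ, 1 ≤ V (Fin.snoc x (b x)) := fun x hx =>
    hV1 _ (KZlog.snoc_mem_band.2 ⟨hx, hbm x hx⟩)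
  have hVa1 : ∀ x ∈ τ, 1 ≤ V (Fin.snoc x (a x)) := fun x hx =>
    hV1 _ (KZlog.snoc_mem_band.2 ⟨hx, ham x hx⟩)
  -- semialgebraic maps `y ↦ (y, 1)` (reading integrands at `u = 1`) and `x ↦ (x, c x)`
  have hmap1 : ∀ {k : ℕ} {S : Set (Fin k → ℝ)}, IsSemialgebraic ℚ S →
      IsSemialgebraicMapOn ℚ S (fun y => (Fin.snoc y (1 : ℝ) : Fin (k + 1) → ℝ)) := by
    intro k S hS
    refine IsSemialgebraicMapOn.of_forall hS fun j => ?_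
    induction j using Fin.lastCases with
    | last => simpa only [Fin.snoc_last] using sa_one hS
    | cast i => simpa only [Fin.snoc_castSucc] using isSemialgebraicFunOn_apply hS i
  have hmapc : ∀ {c : (Fin n → ℝ) → ℝ}, IsSemialgebraicFunOn ℚ τ c →
      IsSemialgebraicMapOn ℚ τ (fun x => (Fin.snoc x (c x) : Fin (n + 1) → ℝ)) := by
    intro c hc
    refine IsSemialgebraicMapOn.of_forall hτ fun j => ?_
    induction j using Fin.lastCases with
    | last => simpa only [Fin.snoc_last] using hc
    | cast i => simpa only [Fin.snoc_castSucc] using isSemialgebraicFunOn_apply hτ i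
  -- (1) `r₄.value = ∫_O H V'/V`
  have hv₄ : r₄.value = ∫ z in openBand τ a b, H z * V' z / V z := by
    show ∫ z in r₄.domain, r₄.integrand z = _
    rw [hBdef, ← setIntegral_congr_set hOB]
    exact setIntegral_congr_fun hOm fun z hz => hr₄i z (openBand_subset_band hz) hz.2.1 hz.2.2
  have hI₄ : IntegrableOn (fun z => H z * V' z / V z) (openBand τ a b) := by
    have h := (hBdef ▸ r₄.integrableOn : IntegrableOn r₄.integrand (KZlog.band τ a b)).mono_set
      openBand_subset_band
    exact h.congr_fun (fun z hz => hr₄i z (openBand_subset_band hz) hz.2.1 hz.2.2) hOm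
  -- (2) `r₂.value = ∫_τ H(x, b x) log V(x, b x)` and (3) the same at `a`
  have hr₂d' : r₂.domain = KZlog.band τ (fun _ => 1) (fun x => V (Fin.snoc x (b x))) := hr₂d
  have hr₃d' : r₃.domain = KZlog.band τ (fun _ => 1) (fun x => V (Fin.snoc x (a x))) := hr₃d
  have h2m : MeasurableSet (KZlog.band τ (fun _ => 1) (fun x => V (Fin.snoc x (b x)))) :=
    hr₂d' ▸ KZ.IntegralRep.measurableSet_domain_holds r₂
  have h3m : MeasurableSet (KZlog.band τ (fun _ => 1) (fun x => V (Fin.snoc x (a x)))) :=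
    hr₃d' ▸ KZ.IntegralRep.measurableSet_domain_holds r₃
  have hv₂ : r₂.value = ∫ x in τ, H (Fin.snoc x (b x)) * Real.log (V (Fin.snoc x (b x))) := by
    show ∫ z in r₂.domain, r₂.integrand z = _
    rw [hr₂d']
    refine setIntegral_unfold_eq hτm hVb1 h2m (hr₂d' ▸ r₂.integrableOn) fun x hx u hu => ?_
    have hmem : (Fin.snoc x u : Fin (n + 1) → ℝ) ∈ r₂.domain := by
      rw [hr₂d']; exact KZlog.snoc_mem_band.2 ⟨hx, hu.1.le, hu.2.le⟩
    rw [hr₂i _ hmem, Fin.init_snoc, Fin.snoc_last]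
  have hv₃ : r₃.value = ∫ x in τ, H (Fin.snoc x (a x)) * Real.log (V (Fin.snoc x (a x))) := by
    show ∫ z in r₃.domain, r₃.integrand z = _
    rw [hr₃d']
    refine setIntegral_unfold_eq hτm hVa1 h3m (hr₃d' ▸ r₃.integrableOn) fun x hx u hu => ?_
    have hmem : (Fin.snoc x u : Fin (n + 1) → ℝ) ∈ r₃.domain := by
      rw [hr₃d']; exact KZlog.snoc_mem_band.2 ⟨hx, hu.1.le, hu.2.le⟩
    rw [hr₃i _ hmem, Fin.init_snoc, Fin.snoc_last]
  -- boundary traces `x ↦ H(x, b x)`, `x ↦ H(x, a x)` are semialgebraic: read `r₂`, `r₃` at `u = 1`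
  have hHb : IsSemialgebraicFunOn ℚ τ fun x => H (Fin.snoc x (b x)) := by
    have hmaps : MapsTo (fun x => (Fin.snoc x (1 : ℝ) : Fin (n + 1) → ℝ)) τ r₂.domain := fun x hx => by
      rw [hr₂d']; exact KZlog.snoc_mem_band.2 ⟨hx, le_rfl, hVb1 x hx⟩
    refine (IsSemialgebraicFunOn.comp_isSemialgebraicMapOn_holds r₂.isSemialgebraicFunOn_integrand
      (hmap1 hτ) hmaps).congr fun x hx => ?_
    show r₂.integrand (Fin.snoc x 1) = H (Fin.snoc x (b x))
    rw [hr₂i (Fin.snoc x 1) (hmaps hx), Fin.init_snoc, Fin.snoc_last, div_one]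
  have hHa : IsSemialgebraicFunOn ℚ τ fun x => H (Fin.snoc x (a x)) := by
    have hmaps : MapsTo (fun x => (Fin.snoc x (1 : ℝ) : Fin (n + 1) → ℝ)) τ r₃.domain := fun x hx => by
      rw [hr₃d']; exact KZlog.snoc_mem_band.2 ⟨hx, le_rfl, hVa1 x hx⟩
    refine (IsSemialgebraicFunOn.comp_isSemialgebraicMapOn_holds r₃.isSemialgebraicFunOn_integrand
      (hmap1 hτ) hmaps).congr fun x hx => ?_
    show r₃.integrand (Fin.snoc x 1) = H (Fin.snoc x (a x))
    rw [hr₃i (Fin.snoc x 1) (hmaps hx), Fin.init_snoc, Fin.snoc_last, div_one]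
  have hVb : IsSemialgebraicFunOn ℚ τ fun x => V (Fin.snoc x (b x)) :=
    IsSemialgebraicFunOn.comp_isSemialgebraicMapOn_holds hV (hmapc hb)
      fun x hx => KZlog.snoc_mem_band.2 ⟨hx, hbm x hx⟩
  have hVa : IsSemialgebraicFunOn ℚ τ fun x => V (Fin.snoc x (a x)) :=
    IsSemialgebraicFunOn.comp_isSemialgebraicMapOn_holds hV (hmapc ha)
      fun x hx => KZlog.snoc_mem_band.2 ⟨hx, ham x hx⟩
  have hlog : ∀ {k : ℕ} {S : Set (Fin k → ℝ)} {f : (Fin k → ℝ) → ℝ}, IsSemialgebraicFunOn ℚ S f →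
      MeasurableSet S → AEStronglyMeasurable (fun x => Real.log (f x)) (volume.restrict S) :=
    fun hf hS => (Real.measurable_log.comp_aemeasurable
      (KZ.aestronglyMeasurable_of_isSemialgebraicFunOn hf hS).aemeasurable).aestronglyMeasurable
  have hmem₂ : ∀ (x : Fin n → ℝ) (u : ℝ), (Fin.snoc x u : Fin (n + 1) → ℝ) ∈ r₂.domain ↔
      x ∈ τ ∧ u ∈ Icc 1 (V (Fin.snoc x (b x))) := fun x u => by
    rw [hr₂d']; exact KZlog.snoc_mem_band
  have hmem₃ : ∀ (x : Fin n → ℝ) (u : ℝ), (Fin.snoc x u : Fin (n + 1) → ℝ) ∈ r₃.domain ↔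
      x ∈ τ ∧ u ∈ Icc 1 (V (Fin.snoc x (a x))) := fun x u => by
    rw [hr₃d']; exact KZlog.snoc_mem_band
  have hintb : IntegrableOn (fun x => H (Fin.snoc x (b x)) * Real.log (V (Fin.snoc x (b x)))) τ := by
    refine integrableOn_of_lintegral_fibre_ge hτm (KZ.IntegralRep.measurableSet_domain_holds r₂)
      hmem₂ r₂.integrableOn
      ((KZ.aestronglyMeasurable_of_isSemialgebraicFunOn hHb hτm).mul (hlog hVb hτm)) fun x hx => ?_
    rw [← KZlog.lintegral_enorm_div_Icc_one _ _ (hVb1 x hx)]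
    refine (setLIntegral_congr_fun measurableSet_Icc fun u hu => ?_).le
    show ‖H (Fin.snoc x (b x)) / u‖ₑ = ‖r₂.integrand (Fin.snoc x u)‖ₑ
    rw [hr₂i _ ((hmem₂ x u).2 ⟨hx, hu⟩), Fin.init_snoc, Fin.snoc_last]
  have hinta : IntegrableOn (fun x => H (Fin.snoc x (a x)) * Real.log (V (Fin.snoc x (a x)))) τ := by
    refine integrableOn_of_lintegral_fibre_ge hτm (KZ.IntegralRep.measurableSet_domain_holds r₃)
      hmem₃ r₃.integrableOn
      ((KZ.aestronglyMeasurable_of_isSemialgebraicFunOn hHa hτm).mul (hlog hVa hτm)) fun x hx => ?_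
    rw [← KZlog.lintegral_enorm_div_Icc_one _ _ (hVa1 x hx)]
    refine (setLIntegral_congr_fun measurableSet_Icc fun u hu => ?_).le
    show ‖H (Fin.snoc x (a x)) / u‖ₑ = ‖r₃.integrand (Fin.snoc x u)‖ₑ
    rw [hr₃i _ ((hmem₃ x u).2 ⟨hx, hu⟩), Fin.init_snoc, Fin.snoc_last]
  -- (4) `r₁.value = ∫_O H' log V`: shrink the base of the unfolded band to the open band (null loss)
  have hr₁d' : r₁.domain = KZlog.band (KZlog.band τ a b) (fun _ => 1) V := hr₁d
  have hD'sa : IsSemialgebraic ℚ (KZlog.band (openBand τ a b) (fun _ => 1) V) :=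
    KZlog.isSemialgebraic_band (sa_one hOsa) (hV.mono openBand_subset_band hOsa)
  have hD'm : MeasurableSet (KZlog.band (openBand τ a b) (fun _ => 1) V) :=
    IsSemialgebraic.measurableSet_holds hD'sa
  have hD'sub : KZlog.band (openBand τ a b) (fun _ => 1) V ⊆ r₁.domain := fun w hw => by
    rw [hr₁d']; exact ⟨openBand_subset_band hw.1, hw.2.1, hw.2.2⟩
  have hN₁ : volume {w : Fin (n + 2) → ℝ | Fin.init w ∈ KZlog.band τ a b \ openBand τ a b} = 0 :=
    KZ.volume_setOf_init_mem_eq_zero hN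
  have hDD' : (KZlog.band (openBand τ a b) (fun _ => 1) V : Set (Fin (n + 2) → ℝ)) =ᵐ[volume]
      (r₁.domain : Set _) := by
    refine ae_eq_set.2 ⟨by rw [Set.sdiff_eq_empty.2 hD'sub, measure_empty], ?_⟩
    refine measure_mono_null (fun w hw => ?_) hN₁
    have hw1 : Fin.init w ∈ KZlog.band τ a b ∧ 1 ≤ w (Fin.last (n + 1)) ∧
        w (Fin.last (n + 1)) ≤ V (Fin.init w) := by
      have h := hw.1; rw [hr₁d'] at h; exact h
    exact ⟨hw1.1, fun ho => hw.2 ⟨ho, hw1.2.1, hw1.2.2⟩⟩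
  have hpin₁ : ∀ z ∈ openBand τ a b, ∀ u ∈ Icc 1 (V z),
      r₁.integrand (Fin.snoc z u) = H' z / u := by
    intro z hz u hu
    have hmem : (Fin.snoc z u : Fin (n + 2) → ℝ) ∈ r₁.domain :=
      hD'sub (KZlog.snoc_mem_band.2 ⟨hz, hu⟩)
    have h := hr₁i _ hmem (by simpa only [Fin.init_snoc] using hz.2.1)
      (by simpa only [Fin.init_snoc] using hz.2.2)
    simpa only [Fin.init_snoc, Fin.snoc_last] using h
  have hv₁ : r₁.value = ∫ z in openBand τ a b, H' z * Real.log (V z) := by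
    show ∫ w in r₁.domain, r₁.integrand w = _
    rw [← setIntegral_congr_set hDD']
    exact setIntegral_unfold_eq hOm hVO1 hD'm (r₁.integrableOn.mono_set hD'sub)
      fun z hz u hu => hpin₁ z hz u ⟨hu.1.le, hu.2.le⟩
  -- `H'` is semialgebraic on the open band: read `r₁` at `u = 1`
  have hH'sa : IsSemialgebraicFunOn ℚ (openBand τ a b) H' := by
    have hmaps : MapsTo (fun z => (Fin.snoc z (1 : ℝ) : Fin (n + 2) → ℝ)) (openBand τ a b) r₁.domain :=
      fun z hz => hD'sub (KZlog.snoc_mem_band.2 ⟨hz, le_rfl, hVO1 z hz⟩)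
    refine (IsSemialgebraicFunOn.comp_isSemialgebraicMapOn_holds r₁.isSemialgebraicFunOn_integrand
      (hmap1 hOsa) hmaps).congr fun z hz => ?_
    show r₁.integrand (Fin.snoc z 1) = H' z
    rw [hpin₁ z hz 1 ⟨le_rfl, hVO1 z hz⟩, div_one]
  have hI₁ : IntegrableOn (fun z => H' z * Real.log (V z)) (openBand τ a b) := by
    refine integrableOn_of_lintegral_fibre_ge hOm hD'm (fun z u => KZlog.snoc_mem_band)
      (r₁.integrableOn.mono_set hD'sub)
      ((KZ.aestronglyMeasurable_of_isSemialgebraicFunOn hH'sa hOm).mul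
        (hlog (hV.mono openBand_subset_band hOsa) hOm)) fun z hz => ?_
    rw [← KZlog.lintegral_enorm_div_Icc_one _ _ (hVO1 z hz)]
    refine (setLIntegral_congr_fun measurableSet_Icc fun u hu => ?_).le
    rw [hpin₁ z hz u hu]
  -- (5) Fubini + FTC for `F = H log V` on the band
  have hG : IntegrableOn (fun z => H' z * Real.log (V z) + H z * V' z / V z) (KZlog.band τ a b) :=
    (hI₁.add hI₄).congr_set_ae hOB.symm
  have hV0 : ∀ x ∈ τ, ∀ t ∈ Icc (a x) (b x), V (Fin.snoc x t) ≠ 0 := fun x hx t ht =>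
    (one_pos.trans_le (hV1 _ (KZlog.snoc_mem_band.2 ⟨hx, ht⟩))).ne'
  have hmain := KZlog.setIntegral_band_eq_of_hasDerivAt hτm hab hBm hG
    (F := fun z => H z * Real.log (V z))
    (fun x hx => (hcont x hx).1.mul ((hcont x hx).2.log fun t ht => hV0 x hx t ht))
    (fun x hx t ht => by
      have h := (hder x hx t ht).1.mul
        ((hder x hx t ht).2.log (hV0 x hx t ⟨ht.1.le, ht.2.le⟩))
      exact h.congr_deriv (by ring))
  -- (6) assemble
  have hsplit : ∫ z in openBand τ a b, (H' z * Real.log (V z) + H z * V' z / V z) =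
      (∫ z in openBand τ a b, H' z * Real.log (V z)) + ∫ z in openBand τ a b, H z * V' z / V z :=
    integral_add hI₁ hI₄
  have hrhs : ∫ x in τ, (H (Fin.snoc x (b x)) * Real.log (V (Fin.snoc x (b x))) -
      H (Fin.snoc x (a x)) * Real.log (V (Fin.snoc x (a x)))) =
      (∫ x in τ, H (Fin.snoc x (b x)) * Real.log (V (Fin.snoc x (b x)))) -
        ∫ x in τ, H (Fin.snoc x (a x)) * Real.log (V (Fin.snoc x (a x))) :=
    integral_sub hintb hinta
  rw [← setIntegral_congr_set hOB, hsplit, hrhs, ← hv₁, ← hv₄, ← hv₂, ← hv₃] at hmain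
  linarith

/-- **Any kill of `WithoutSaH` disproves the Kontsevich–Zagier period conjecture**: the combination is
a kernel element whatever `H` is (`values_cancel_without_saH`), so `KZKernelConjecture` (= the summit
in kernel form) implies the `H`-semialgebraicity-free variant. -/
theorem withoutSaH_of_kzKernelConjecture (hK : KZKernelConjecture) : WithoutSaH := by
  intro n τ a b H H' V V' r₁ r₂ r₃ r₄ hτ ha hb hab hr₄d hV hV1 hcont hder hr₄i hr₁d hr₁i hr₂d hr₂i
    hr₃d hr₃i
  apply hK
  have h := values_cancel_without_saH n τ a b H H' V V' r₁ r₂ r₃ r₄ hτ ha hb hab hr₄d hV hV1 hcont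
    hder hr₄i hr₁d hr₁i hr₂d hr₂i hr₃d hr₃i
  simpa [map_add, map_sub, KZ.eval_of] using h

/-- Contrapositive, the form a refuter reads: a counterexample to `WithoutSaH` is a counterexample to
`KZKernelConjecture`. -/
theorem not_kzKernelConjecture_of_not_withoutSaH (h : ¬ WithoutSaH) : ¬ KZKernelConjecture :=
  fun hK => h (withoutSaH_of_kzKernelConjecture hK)

end Invisible



end Summit.KontsevichZagierPeriods.KontsevichZagierPeriods.Cruxes.UnfoldedLogStokes.Disproof
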